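import Literature.Analysis.FluidPDE.PineauVicolGaussSobolev
import Literature.Analysis.FluidPDE.WholeSpaceIBPIntegrable
import HarnessLib

/-!
# Pineau–Vicol 2026, Lemma 6.2 (i)–(ii) and (6.18): the rotation operator `𝓡` is skew-adjoint on
# `L²_γ`, `−Δ + ½ y·∇` is symmetric on `L²_γ`, and `|α| ‖𝓡U‖²_{L²_γ} = sgn(α) ⟨𝓡U, 𝓝⟩_{L²_γ}`

Analysis/FluidPDE proofs file (theorems only; no definition, no named fact), a companion of the
named facts `pineauVicol2026_rss_liouville` / `pineauVicol2026_rdss_liouville`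
(`PineauVicolRSS.lean`) after `PineauVicolWeightedIdentity.lean` ((5.4)) and
`PineauVicolGaussSobolev.lean` (the Gaussian weight `γ = gaussWeight`, (6.7)).
B. Pineau, V. Vicol, *On rotated backwards self-similar solutions of the incompressible 3D
Navier–Stokes equations*, arXiv:2607.09619v2 (2026), **§6 "RSS: proof of the main result for
`α` large"** (pp. 18–22). With `J = rotGen` (`J V = (−V₂, V₁, 0)`, `J y = r e_θ`,
`(Jy)·∇ = ∂_θ`) the paper defines the rotation operator

  `𝓡 V := J V − (J y)·∇ V`                                                        (6.1)

("`𝓡` acts on vector fields by applying `−∂_θ` to each cylindrical component", (6.2)), the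
Gaussian weight `μ(y) = e^{−|y|²/4}` and `⟨V, G⟩_{L²_μ} = ∫ V·G μ dy` (6.7), and records
(Lemma 6.2): "(i) The operator `−Δ + ½ y·∇` is self-adjoint on `L²_μ(ℝ³)` and
`⟨(−Δ + ½ y·∇)V, V⟩_{L²_μ} = ‖∇V‖²_{L²_μ}`. (ii) `⟨𝓡V, G⟩_{L²_μ} = −⟨V, 𝓡G⟩_{L²_μ}` …".
Rewriting the rotated profile system (1.8) as

  `α 𝓡U + ½ U + (−Δ + ½ (y·∇)) U = 𝓝`,  `∇·U = 0`,  `𝓝 := −(U·∇)U − ∇P` (6.10)   (6.16a,b)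

the proof of Lemma 6.4 (p. 21) reads: "the operators `𝓡` and `−Δ + ½ y·∇` commute … Item (ii)
of Lemma 6.2 shows that `𝓡` is skew-adjoint on `L²_μ`, whereas item (i) shows that `−Δ + ½ y·∇`
is self-adjoint. Combined, these facts yield `⟨𝓡U, (−Δ + ½ y·∇)U⟩_{L²_μ} = 0`. Since we also
have `⟨𝓡U, U⟩_{L²_μ} = 0`, taking the `L²_μ` inner product of (6.16a) with `sgn(α) 𝓡U` … we
obtain

  `|α| ‖𝓡U‖²_{L²_μ} = sgn(α) ⟨𝓡U, 𝓝⟩_{L²_μ}`                                      (6.18)"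

— the quantitative "fast rotation ⇒ near-axisymmetry in `L²_μ`" identity that, with the source
bound Lemma 6.3 and the angular Poincaré inequality, gives Prop. 6.5
(`|α| ‖𝓡U‖_{L²_μ} ≤ ε` for `|α| ≥ A_ε`).

## What is proved here (all on `ℝ³ = EuclideanSpace ℝ (Fin 3)`, `γ = gaussWeight`, `J = rotGen`,
## `𝓡V(y)` written out as `rotGen (V y) − fderiv ℝ V y (rotGen y)`)

* `integral_gaussWeight_mul_fderiv_rotGen_eq_zero` — **angular transport**: `∫ γ(y) Df(y)[Jy] dy = 0`
  for `f ∈ C¹` (since `div(γ f J y) = γ Df[Jy]`: `div(Jy) = 0` and `⟪∇γ, Jy⟫ = −½γ⟪y, Jy⟫ = 0`);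
* `integral_gaussWeight_mul_inner_rotOp_self_eq_zero` — **`⟨𝓡U, U⟩_{L²_γ} = 0`** (the diagonal
  of Lemma 6.2 (ii)): pointwise `⟪JU, U⟫ = 0` and `⟪DU[Jy], U⟫ = ½ D|U|²[Jy]`; the companion
  `integral_gaussWeight_mul_inner_fderiv_rotGen_self_eq_zero` is `∫ γ ⟪DV[Jy], V⟫ = 0` alone;
* `integral_gaussWeight_mul_inner_rotOp_eq_neg` — **Lemma 6.2 (ii), first identity**,
  `⟨𝓡V, G⟩_{L²_γ} = −⟨V, 𝓡G⟩_{L²_γ}`;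
* `integral_gaussWeight_mul_inner_ou_eq` — **Lemma 6.2 (i), polarized**:
  `⟨(−Δ + ½ y·∇)U, G⟩_{L²_γ} = Σᵢ ⟨∂ᵢU, ∂ᵢG⟩_{L²_γ}` for `U ∈ C²`, `G ∈ C¹` (whole-space
  integration by parts with `∇γ = −½ γ y`); the printed diagonal case `G = U` is
  `integral_gaussWeight_mul_inner_ou_self`;
* `integral_gaussWeight_mul_inner_ou_rotOp_eq_zero` — **`⟨(−Δ + ½ y·∇)U, 𝓡U⟩_{L²_γ} = 0`**
  (the commutation step of the proof of Lemma 6.4, proved directly: by the polarized (i) the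
  pairing is `Σᵢ ⟨∂ᵢU, ∂ᵢ(𝓡U)⟩_γ`, and `∂ᵢ(𝓡U) = J∂ᵢU − D(∂ᵢU)[Jy] − DU[Jeᵢ]`; the first term
  pairs to `0` pointwise, the second integrates to `0` by angular transport of `½|∂ᵢU|²`, and
  `Σᵢ ⟪∂ᵢU, DU[Jeᵢ]⟫ = ⟪∂₀U, ∂₁U⟫ − ⟪∂₁U, ∂₀U⟫ = 0`);
* `abs_mul_integral_gaussWeight_mul_norm_rotOp_sq` — **(6.18)**: for a `C²` solution of (6.16a)
  (the tree's rendering of (1.8), as in `integral_weight_mul_norm_curl_sq`),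
  `|α| ∫ γ |𝓡U|² = sgn(α) ∫ γ ⟪𝓡U, 𝓝⟫` with `𝓝 = −(U·∇)U − ∇P`; the unsigned form
  `α ∫ γ |𝓡U|² = ∫ γ ⟪𝓡U, 𝓝⟫` is `mul_integral_gaussWeight_mul_norm_rotOp_sq`;
* `half_mul_integral_gaussWeight_mul_norm_sq_add` — **the `L²_γ` energy identity
  `½‖U‖²_γ + ‖∇U‖²_γ = ⟨𝓝, U⟩_γ`** (pairing (6.16a) with `U`; the paper prints the same two steps
  for the angular fluctuation `(U)_a`, the identity preceding (6.19), p. 22);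
* `half_mul_integral_gaussWeight_mul_norm_sq_add_eq_head_flux` —
  **`½‖U‖²_γ + ‖∇U‖²_γ = −½ ∫ γ (½|U|² + P)(U·y)`** for `∇·U = 0`: the energy identity followed
  by the two (private, folklore) Gaussian integrations by parts `⟨(U·∇)U, U⟩_γ = ¼∫γ(U·y)|U|²`,
  `⟨∇P, U⟩_γ = ½∫γP(U·y)` (compact-support form already in the tree as
  `integral_gaussian_inner_convect_self`) — Bernoulli head against the radial flux; this
  combination is not displayed in the paper;
* `integral_gaussWeight_mul_inner_sliceDeriv_eq` — the same balance with the time derivative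
  `U_s := ∂_sU` of the similarity/RDSS ansatz retained in the equation (as in (7.7), p. 25):
  **`⟨U_s, U⟩_γ = −½‖U‖²_γ − ‖∇U‖²_γ − ½∫γ(½|U|² + P)(U·y)`** (the steady case `U_s = 0` is the
  previous item; the bookkeeping `⟨∂_sU, U⟩_γ = d/ds ½‖U‖²_γ` is not part of the statement);
* `intervalIntegral_gaussEnergy_balance_eq_zero_of_periodic` — the **period average** for an
  `s`-periodic solution (`U(L) = U(0)`; (R)DSS members in similarity variables):
  **`∫₀ᴸ (½‖U(s)‖²_γ + ‖∇U(s)‖²_γ + ½∫γ(½|U|² + P)(U·y)) ds = 0`**, by dominated differentiation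
  of `½‖U(s)‖²_γ` (private `hasDerivAt_integral_gaussWeight_mul_norm_sq`) and the fundamental
  theorem of calculus over one period.

Hypotheses. The paper works with smooth profiles obeying the Type I bounds (1.9), (2.1)–(2.2)
(`|∇ᵏU(y)| ≲ (1 + |y|)^{−1−k}`); here every statement carries instead **polynomial growth
bounds** `|U|, |DU|, |D²U|, |G|, |DG| ≤ C (1 + |y|)ᴺ` (resp. `|f|, |Df| ≤ C(1 + |y|)ᴺ`), which the
printed class satisfies with `N = 0` and which make every Gaussian-weighted integrand integrable
(`integrable_one_add_norm_pow_mul_exp_neg_mul_sq` of `PineauVicolWeightedIdentity.lean`).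
The divergence-free condition (6.16b) is not needed for (6.18) or for the energy identity
`½‖U‖²_γ + ‖∇U‖²_γ = ⟨𝓝, U⟩_γ` and is not assumed there; it enters only the two integrations
by parts of `⟨𝓝, U⟩_γ` (as `VectorCalculus.IsDivFree U`).

Not here: the second identity of Lemma 6.2 (ii) (`⟨𝓡V, G⟩ = ⟨𝓡V, (G)_a⟩`) and Lemma 6.2
(iii)–(vi) (angular mean `⟨V⟩_θ` (6.3)–(6.6) and the angular Poincaré inequality (6.9), which need
cylindrical coordinates), Lemma 6.3 (the source bound (6.11)), and hence Lemma 6.4 (6.17) /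
Prop. 6.5 (6.20) themselves.

## References

* B. Pineau, V. Vicol, arXiv:2607.09619v2 (2026), §6.1 (6.1)–(6.2), §6.2 (6.7) and Lemma 6.2,
  §6.4 (6.16)–(6.18) and the proof of Lemma 6.4 (pp. 18–21). [PineauVicol2026]
* L. C. Evans, *Partial Differential Equations*, 2nd ed. (2010), App. C.2 (integration by parts
  on the whole space, as in `WholeSpaceIBPIntegrable.lean`). [Evans2010]
-/

noncomputable section

open Set InnerProductSpace MeasureTheory Filter Real
open scoped RealInnerProductSpace Laplacian ContDiff Topology BigOperators

namespace Literature.Analysis.FluidPDE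

namespace PineauVicol2026

/-! ### Algebra of the generator `J = rotGen` -/

/-- `J` is skew: `⟪J v, w⟫ = −⟪v, J w⟫`. [folklore] -/
private theorem inner_rotGen_skew (v w : EuclideanSpace ℝ (Fin 3)) :
    ⟪rotGen v, w⟫ = -⟪v, rotGen w⟫ := by
  rw [inner_rotGen_left, real_inner_comm, inner_rotGen_left]; ring

/-- `⟪v, J v⟫ = 0`. [folklore] -/
private theorem inner_rotGen_self_right (v : EuclideanSpace ℝ (Fin 3)) : ⟪v, rotGen v⟫ = 0 := by
  rw [real_inner_comm, inner_rotGen_self]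

/-- `J` is smooth (it is linear). [folklore] -/
private theorem contDiff_rotGen' {n : WithTop ℕ∞} :
    ContDiff ℝ n (rotGen : EuclideanSpace ℝ (Fin 3) → EuclideanSpace ℝ (Fin 3)) := by
  have h : (rotGen : EuclideanSpace ℝ (Fin 3) → EuclideanSpace ℝ (Fin 3)) = fun x => rotGenL x :=
    funext fun x => (rotGenL_apply x).symm
  rw [h]; exact rotGenL.contDiff

/-- `div (J y) = tr J = 0`. [folklore] -/
private theorem divergence_rotGen (y : EuclideanSpace ℝ (Fin 3)) :
    VectorCalculus.divergence rotGen y = 0 := by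
  rw [divergence_eq_sum_inner_fderiv (EuclideanSpace.basisFun (Fin 3) ℝ), (hasFDerivAt_rotGen y).fderiv]
  refine Finset.sum_eq_zero fun i _ => ?_
  rw [rotGenL_apply, inner_rotGen_self_right]

/-! ### Integrability against the Gaussian weight under polynomial growth -/

/-- A continuous function with polynomial growth is integrable against `γ`:
`‖g y‖ ≤ C(1 + ‖y‖)ᴺ ⇒ γ • g ∈ L¹`. [cite: PineauVicol2026, proof of Theorem 1.4, small |α| case (p. 13)] -/
theorem integrable_gaussWeight_smul_of_norm_le {F : Type*} [NormedAddCommGroup F] [NormedSpace ℝ F]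
    {g : EuclideanSpace ℝ (Fin 3) → F} (hg : Continuous g) {C : ℝ} {N : ℕ}
    (h : ∀ y, ‖g y‖ ≤ C * (1 + ‖y‖) ^ N) :
    Integrable fun y => gaussWeight y • g y := by
  have hi := (integrable_one_add_norm_pow_mul_exp_neg_mul_sq (E := EuclideanSpace ℝ (Fin 3))
    (c := 1 / 4) (by norm_num) N).const_mul C
  refine hi.mono' (continuous_gaussWeight.smul hg).aestronglyMeasurable
    (Eventually.of_forall fun y => ?_)
  rw [norm_smul, Real.norm_of_nonneg (gaussWeight_pos y).le, gaussWeight_eq]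
  have hγ : 0 ≤ rexp (-(1 / 4 : ℝ) * ‖y‖ ^ 2) := (Real.exp_pos _).le
  calc rexp (-(1 / 4 : ℝ) * ‖y‖ ^ 2) * ‖g y‖
      ≤ rexp (-(1 / 4 : ℝ) * ‖y‖ ^ 2) * (C * (1 + ‖y‖) ^ N) := mul_le_mul_of_nonneg_left (h y) hγ
    _ = C * ((1 + ‖y‖) ^ N * rexp (-(1 / 4 : ℝ) * ‖y‖ ^ 2)) := by ring

/-- Scalar version: `‖g y‖ ≤ C(1 + ‖y‖)ᴺ ⇒ γ g ∈ L¹`. [cite: PineauVicol2026, proof of Theorem 1.4, small |α| case (p. 13)] -/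
theorem integrable_gaussWeight_mul_of_norm_le {g : EuclideanSpace ℝ (Fin 3) → ℝ} (hg : Continuous g)
    {C : ℝ} {N : ℕ} (h : ∀ y, ‖g y‖ ≤ C * (1 + ‖y‖) ^ N) :
    Integrable fun y => gaussWeight y * g y :=
  integrable_gaussWeight_smul_of_norm_le hg h

/-! ### Angular transport: `∫ γ Df[Jy] = 0` -/

/-- **Angular transport against the Gaussian.** For `f ∈ C¹(ℝ³)` with `|f|, |Df| ≤ C(1 + |y|)ᴺ`:
`∫ γ(y) Df(y)[J y] dy = 0` — because `div(γ f · J y) = γ Df[Jy] + f ⟪∇γ, Jy⟫ + γ f div(Jy)` and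
`⟪∇γ, Jy⟫ = −½ γ ⟪y, Jy⟫ = 0`, `div(Jy) = 0` (`∂_θ` is a divergence-free field tangent to the
level sets of `γ`; this is the integration by parts behind Lemma 6.2 (ii), "by (6.2), (6.3), and
integration by parts"). [cite: PineauVicol2026, Lemma 6.2 (ii) and its proof (pp. 19–20)] -/
theorem integral_gaussWeight_mul_fderiv_rotGen_eq_zero {f : EuclideanSpace ℝ (Fin 3) → ℝ}
    (hf : ContDiff ℝ 1 f) {C : ℝ} {N : ℕ} (h0 : ∀ y, ‖f y‖ ≤ C * (1 + ‖y‖) ^ N)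
    (h1 : ∀ y, ‖fderiv ℝ f y‖ ≤ C * (1 + ‖y‖) ^ N) :
    ∫ y, gaussWeight y * fderiv ℝ f y (rotGen y) = 0 := by
  have hC : 0 ≤ C := by
    have := (norm_nonneg (f 0)).trans (h0 0)
    simpa using this
  have hγ1 : ContDiff ℝ 1 (gaussWeight : EuclideanSpace ℝ (Fin 3) → ℝ) := contDiff_gaussWeight (n := 1)
  have hθ : ContDiff ℝ 1 (fun y => gaussWeight y * f y) := hγ1.mul hf
  -- the pointwise identity `⟪J y, ∇(γ f)(y)⟫ = γ(y) Df(y)[Jy]`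
  have hpt : ∀ y, ⟪rotGen y, gradient (fun z => gaussWeight z * f z) y⟫ =
      gaussWeight y * fderiv ℝ f y (rotGen y) := by
    intro y
    have hdγ : DifferentiableAt ℝ gaussWeight y := (hγ1.differentiable one_ne_zero) y
    have hdf : DifferentiableAt ℝ f y := (hf.differentiable one_ne_zero) y
    rw [real_inner_comm, inner_gradient_left, fderiv_fun_mul hdγ hdf]
    simp [fderiv_gaussWeight_apply, inner_rotGen_self_right]
  -- integrability of `γ f • J y` and of `γ Df[Jy]`
  have hint : Integrable fun y => (gaussWeight y * f y) • rotGen y := by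
    have e : (fun y => (gaussWeight y * f y) • rotGen y) = fun y => gaussWeight y • (f y • rotGen y) := by
      funext y; rw [mul_smul]
    rw [e]
    refine integrable_gaussWeight_smul_of_norm_le (hf.continuous.smul (contDiff_rotGen' (n := 1)).continuous)
      (C := C) (N := N + 1) fun y => ?_
    rw [norm_smul]
    calc ‖f y‖ * ‖rotGen y‖ ≤ C * (1 + ‖y‖) ^ N * (1 + ‖y‖) := by
          refine mul_le_mul (h0 y) ((norm_rotGen_le y).trans (by linarith [norm_nonneg y]))
            (norm_nonneg _) (by positivity)
      _ = C * (1 + ‖y‖) ^ (N + 1) := by ring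
  have hint2 : Integrable fun y => gaussWeight y * fderiv ℝ f y (rotGen y) := by
    refine integrable_gaussWeight_mul_of_norm_le
      (((hf.continuous_fderiv one_ne_zero).clm_apply (contDiff_rotGen' (n := 1)).continuous))
      (C := C) (N := N + 1) fun y => ?_
    calc ‖fderiv ℝ f y (rotGen y)‖ ≤ ‖fderiv ℝ f y‖ * ‖rotGen y‖ := ContinuousLinearMap.le_opNorm _ _
      _ ≤ C * (1 + ‖y‖) ^ N * (1 + ‖y‖) := by
          refine mul_le_mul (h1 y) ((norm_rotGen_le y).trans (by linarith [norm_nonneg y]))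
            (norm_nonneg _) (by positivity)
      _ = C * (1 + ‖y‖) ^ (N + 1) := by ring
  have key := integral_mul_divergence_add_eq_zero_of_integrable hθ contDiff_rotGen' hint
    (by simp only [divergence_rotGen, mul_zero]; exact integrable_zero _ _ _)
    (by simp_rw [hpt]; exact hint2)
  simp only [divergence_rotGen, mul_zero, integral_zero, zero_add] at key
  simp_rw [hpt] at key
  exact key


/-! ### Lemma 6.2 (ii): `𝓡` is skew-adjoint on `L²_γ` -/

/-- The operator norm of `y ↦ ⟪V y, DG y ·⟫ + ⟪DV y ·, G y⟫` (the derivative of `⟪V, G⟫`) is at most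
`‖V‖‖DG‖ + ‖DV‖‖G‖`. [folklore] -/
private theorem norm_fderiv_inner_le {V G : EuclideanSpace ℝ (Fin 3) → EuclideanSpace ℝ (Fin 3)}
    (hV : ContDiff ℝ 1 V) (hG : ContDiff ℝ 1 G) (y : EuclideanSpace ℝ (Fin 3)) :
    ‖fderiv ℝ (fun z => ⟪V z, G z⟫) y‖ ≤ ‖V y‖ * ‖fderiv ℝ G y‖ + ‖fderiv ℝ V y‖ * ‖G y‖ := by
  refine ContinuousLinearMap.opNorm_le_bound _ (by positivity) fun v => ?_
  rw [fderiv_inner_apply ℝ ((hV.differentiable one_ne_zero) y) ((hG.differentiable one_ne_zero) y)]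
  calc ‖⟪V y, fderiv ℝ G y v⟫ + ⟪fderiv ℝ V y v, G y⟫‖
      ≤ ‖⟪V y, fderiv ℝ G y v⟫‖ + ‖⟪fderiv ℝ V y v, G y⟫‖ := norm_add_le _ _
    _ ≤ ‖V y‖ * ‖fderiv ℝ G y v‖ + ‖fderiv ℝ V y v‖ * ‖G y‖ :=
        add_le_add (norm_inner_le_norm _ _) (norm_inner_le_norm _ _)
    _ ≤ ‖V y‖ * (‖fderiv ℝ G y‖ * ‖v‖) + (‖fderiv ℝ V y‖ * ‖v‖) * ‖G y‖ := by
        gcongr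
        · exact ContinuousLinearMap.le_opNorm _ _
        · exact ContinuousLinearMap.le_opNorm _ _
    _ = (‖V y‖ * ‖fderiv ℝ G y‖ + ‖fderiv ℝ V y‖ * ‖G y‖) * ‖v‖ := by ring

/-- **Lemma 6.2 (ii) (p. 19): `⟨𝓡V, G⟩_{L²_μ} = −⟨V, 𝓡G⟩_{L²_μ}`** — the rotation operator
`𝓡V = JV − (Jy·∇)V` (6.1) is skew-adjoint on the Gaussian-weighted `L²`, for `C¹` fields of
polynomial growth (printed for smooth fields; "by (6.2), (6.3), and integration by parts … using
definition (6.7)"). Here: `⟪JV, G⟫ + ⟪V, JG⟫ = 0` pointwise and `⟪DV[Jy], G⟫ + ⟪V, DG[Jy]⟫ = D⟪V,G⟫[Jy]`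
integrates to `0` against `γ` by angular transport. [cite: PineauVicol2026, Lemma 6.2 (ii) (p. 19)] -/
theorem integral_gaussWeight_mul_inner_rotOp_eq_neg
    {V G : EuclideanSpace ℝ (Fin 3) → EuclideanSpace ℝ (Fin 3)} (hV : ContDiff ℝ 1 V) (hG : ContDiff ℝ 1 G)
    {C : ℝ} {N : ℕ} (hV0 : ∀ y, ‖V y‖ ≤ C * (1 + ‖y‖) ^ N) (hV1 : ∀ y, ‖fderiv ℝ V y‖ ≤ C * (1 + ‖y‖) ^ N)
    (hG0 : ∀ y, ‖G y‖ ≤ C * (1 + ‖y‖) ^ N) (hG1 : ∀ y, ‖fderiv ℝ G y‖ ≤ C * (1 + ‖y‖) ^ N) :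
    ∫ y, gaussWeight y * ⟪rotGen (V y) - fderiv ℝ V y (rotGen y), G y⟫ =
      -∫ y, gaussWeight y * ⟪V y, rotGen (G y) - fderiv ℝ G y (rotGen y)⟫ := by
  have hC : 0 ≤ C := by
    have := (norm_nonneg (V 0)).trans (hV0 0)
    simpa using this
  have hJc : Continuous (rotGen : EuclideanSpace ℝ (Fin 3) → EuclideanSpace ℝ (Fin 3)) :=
    (contDiff_rotGen' (n := 1)).continuous
  have hb : ∀ y : EuclideanSpace ℝ (Fin 3), 0 ≤ C * (1 + ‖y‖) ^ N := fun y => by positivity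
  have hy1 : ∀ y : EuclideanSpace ℝ (Fin 3), ‖rotGen y‖ ≤ 1 + ‖y‖ := fun y =>
    (norm_rotGen_le y).trans (by linarith [norm_nonneg y])
  -- the scalar `f = ⟪V, G⟫` and its angular transport
  have hf : ContDiff ℝ 1 fun z => ⟪V z, G z⟫ := hV.inner ℝ hG
  have hDf : ∀ y, fderiv ℝ (fun z => ⟪V z, G z⟫) y (rotGen y) =
      ⟪V y, fderiv ℝ G y (rotGen y)⟫ + ⟪fderiv ℝ V y (rotGen y), G y⟫ := fun y =>
    fderiv_inner_apply ℝ ((hV.differentiable one_ne_zero) y) ((hG.differentiable one_ne_zero) y) _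
  have key := integral_gaussWeight_mul_fderiv_rotGen_eq_zero hf (C := 2 * C ^ 2) (N := 2 * N)
    (fun y => by
      calc ‖⟪V y, G y⟫‖ ≤ ‖V y‖ * ‖G y‖ := norm_inner_le_norm _ _
        _ ≤ (C * (1 + ‖y‖) ^ N) * (C * (1 + ‖y‖) ^ N) :=
            mul_le_mul (hV0 y) (hG0 y) (norm_nonneg _) (hb y)
        _ = C ^ 2 * (1 + ‖y‖) ^ (2 * N) := by ring
        _ ≤ 2 * C ^ 2 * (1 + ‖y‖) ^ (2 * N) := by
            have : 0 ≤ C ^ 2 * (1 + ‖y‖) ^ (2 * N) := by positivity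
            linarith)
    (fun y => by
      calc ‖fderiv ℝ (fun z => ⟪V z, G z⟫) y‖
          ≤ ‖V y‖ * ‖fderiv ℝ G y‖ + ‖fderiv ℝ V y‖ * ‖G y‖ := norm_fderiv_inner_le hV hG y
        _ ≤ (C * (1 + ‖y‖) ^ N) * (C * (1 + ‖y‖) ^ N) + (C * (1 + ‖y‖) ^ N) * (C * (1 + ‖y‖) ^ N) :=
            add_le_add (mul_le_mul (hV0 y) (hG1 y) (norm_nonneg _) (hb y))
              (mul_le_mul (hV1 y) (hG0 y) (norm_nonneg _) (hb y))
        _ = 2 * C ^ 2 * (1 + ‖y‖) ^ (2 * N) := by ring)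
  -- integrability of the two weighted pairings
  have iV : Integrable fun y => gaussWeight y * ⟪V y, fderiv ℝ G y (rotGen y)⟫ := by
    refine integrable_gaussWeight_mul_of_norm_le
      (hV.continuous.inner (((hG.continuous_fderiv one_ne_zero).clm_apply hJc))) (C := C ^ 2)
      (N := 2 * N + 1) fun y => ?_
    calc ‖⟪V y, fderiv ℝ G y (rotGen y)⟫‖ ≤ ‖V y‖ * ‖fderiv ℝ G y (rotGen y)‖ := norm_inner_le_norm _ _
      _ ≤ ‖V y‖ * (‖fderiv ℝ G y‖ * ‖rotGen y‖) :=
          mul_le_mul_of_nonneg_left (ContinuousLinearMap.le_opNorm _ _) (norm_nonneg _)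
      _ ≤ (C * (1 + ‖y‖) ^ N) * ((C * (1 + ‖y‖) ^ N) * (1 + ‖y‖)) :=
          mul_le_mul (hV0 y) (mul_le_mul (hG1 y) (hy1 y) (norm_nonneg _) (hb y))
            (mul_nonneg (norm_nonneg _) (norm_nonneg _)) (hb y)
      _ = C ^ 2 * (1 + ‖y‖) ^ (2 * N + 1) := by ring
  have iG : Integrable fun y => gaussWeight y * ⟪fderiv ℝ V y (rotGen y), G y⟫ := by
    refine integrable_gaussWeight_mul_of_norm_le
      ((((hV.continuous_fderiv one_ne_zero).clm_apply hJc)).inner hG.continuous) (C := C ^ 2)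
      (N := 2 * N + 1) fun y => ?_
    calc ‖⟪fderiv ℝ V y (rotGen y), G y⟫‖ ≤ ‖fderiv ℝ V y (rotGen y)‖ * ‖G y‖ := norm_inner_le_norm _ _
      _ ≤ (‖fderiv ℝ V y‖ * ‖rotGen y‖) * ‖G y‖ :=
          mul_le_mul_of_nonneg_right (ContinuousLinearMap.le_opNorm _ _) (norm_nonneg _)
      _ ≤ ((C * (1 + ‖y‖) ^ N) * (1 + ‖y‖)) * (C * (1 + ‖y‖) ^ N) :=
          mul_le_mul (mul_le_mul (hV1 y) (hy1 y) (norm_nonneg _) (hb y)) (hG0 y) (norm_nonneg _)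
            (by positivity)
      _ = C ^ 2 * (1 + ‖y‖) ^ (2 * N + 1) := by ring
  -- pointwise: `γ⟪JV − DV[Jy], G⟫ = −γ⟪V, JG − DG[Jy]⟫ − γ D⟪V,G⟫[Jy]`
  have e1 : (fun y => gaussWeight y * ⟪rotGen (V y) - fderiv ℝ V y (rotGen y), G y⟫) = fun y =>
      -(gaussWeight y * ⟪V y, rotGen (G y)⟫) - gaussWeight y * ⟪fderiv ℝ V y (rotGen y), G y⟫ := by
    funext y; rw [inner_sub_left, inner_rotGen_skew]; ring
  have e2 : (fun y => gaussWeight y * ⟪V y, rotGen (G y) - fderiv ℝ G y (rotGen y)⟫) = fun y =>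
      gaussWeight y * ⟪V y, rotGen (G y)⟫ - gaussWeight y * ⟪V y, fderiv ℝ G y (rotGen y)⟫ := by
    funext y; rw [inner_sub_right]; ring
  have iJ : Integrable fun y => gaussWeight y * ⟪V y, rotGen (G y)⟫ := by
    refine integrable_gaussWeight_mul_of_norm_le (hV.continuous.inner (hJc.comp hG.continuous))
      (C := C ^ 2) (N := 2 * N) fun y => ?_
    calc ‖⟪V y, rotGen (G y)⟫‖ ≤ ‖V y‖ * ‖rotGen (G y)‖ := norm_inner_le_norm _ _
      _ ≤ (C * (1 + ‖y‖) ^ N) * (C * (1 + ‖y‖) ^ N) :=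
          mul_le_mul (hV0 y) ((norm_rotGen_le _).trans (hG0 y)) (norm_nonneg _) (hb y)
      _ = C ^ 2 * (1 + ‖y‖) ^ (2 * N) := by ring
  have e3 : (fun y => gaussWeight y * fderiv ℝ (fun z => ⟪V z, G z⟫) y (rotGen y)) = fun y =>
      gaussWeight y * ⟪V y, fderiv ℝ G y (rotGen y)⟫ + gaussWeight y * ⟪fderiv ℝ V y (rotGen y), G y⟫ := by
    funext y; rw [hDf]; ring
  rw [e3, integral_add iV iG] at key
  have iJn : Integrable fun y => -(gaussWeight y * ⟪V y, rotGen (G y)⟫) := iJ.neg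
  rw [e1, e2, integral_sub iJn iG, integral_neg, integral_sub iJ iV]
  linarith

/-- **`⟨𝓡U, U⟩_{L²_μ} = 0`** (proof of Lemma 6.4, p. 21: "Since we also have
`⟨𝓡U, U⟩_{L²_μ} = 0`"): the diagonal of the skew-adjointness, for a `C¹` field of polynomial
growth. [cite: PineauVicol2026, proof of Lemma 6.4 (p. 21)] -/
theorem integral_gaussWeight_mul_inner_rotOp_self_eq_zero
    {U : EuclideanSpace ℝ (Fin 3) → EuclideanSpace ℝ (Fin 3)} (hU : ContDiff ℝ 1 U)
    {C : ℝ} {N : ℕ} (hU0 : ∀ y, ‖U y‖ ≤ C * (1 + ‖y‖) ^ N) (hU1 : ∀ y, ‖fderiv ℝ U y‖ ≤ C * (1 + ‖y‖) ^ N) :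
    ∫ y, gaussWeight y * ⟪rotGen (U y) - fderiv ℝ U y (rotGen y), U y⟫ = 0 := by
  have h := integral_gaussWeight_mul_inner_rotOp_eq_neg hU hU hU0 hU1 hU0 hU1
  have e : (fun y => gaussWeight y * ⟪U y, rotGen (U y) - fderiv ℝ U y (rotGen y)⟫) = fun y =>
      gaussWeight y * ⟪rotGen (U y) - fderiv ℝ U y (rotGen y), U y⟫ := by
    funext y; rw [real_inner_comm]
  rw [e] at h
  linarith

/-- **`∫ γ ⟪DV[Jy], V⟫ = 0`** for a `C¹` field of polynomial growth (from `⟨𝓡V, V⟩_γ = 0` and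
`⟪JV, V⟫ = 0`): the form of the angular transport used on the gradient in the commutation step.
[cite: PineauVicol2026, proof of Lemma 6.4 (p. 21)] -/
theorem integral_gaussWeight_mul_inner_fderiv_rotGen_self_eq_zero
    {V : EuclideanSpace ℝ (Fin 3) → EuclideanSpace ℝ (Fin 3)} (hV : ContDiff ℝ 1 V)
    {C : ℝ} {N : ℕ} (hV0 : ∀ y, ‖V y‖ ≤ C * (1 + ‖y‖) ^ N) (hV1 : ∀ y, ‖fderiv ℝ V y‖ ≤ C * (1 + ‖y‖) ^ N) :
    ∫ y, gaussWeight y * ⟪fderiv ℝ V y (rotGen y), V y⟫ = 0 := by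
  have h := integral_gaussWeight_mul_inner_rotOp_self_eq_zero hV hV0 hV1
  have e : (fun y => gaussWeight y * ⟪rotGen (V y) - fderiv ℝ V y (rotGen y), V y⟫) = fun y =>
      -(gaussWeight y * ⟪fderiv ℝ V y (rotGen y), V y⟫) := by
    funext y; rw [inner_sub_left, inner_rotGen_self]; ring
  rw [e, integral_neg, neg_eq_zero] at h
  exact h


/-! ### Lemma 6.2 (i): `−Δ + ½ y·∇` is symmetric on `L²_γ` -/

/-- Whole-space integration by parts in one direction, `L¹` form: for `h ∈ C¹(ℝ³; F)` with `h` and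
`∂ᵥh` integrable, `∫ ∂ᵥh = 0` (Mathlib's integration by parts against the constant `1`).
[cite: Evans2010, App. C.2, Thm. 1] -/
private theorem integral_fderiv_apply_eq_zero_of_integrable' {F : Type*} [NormedAddCommGroup F]
    [NormedSpace ℝ F] [CompleteSpace F] {h : EuclideanSpace ℝ (Fin 3) → F} (hh : ContDiff ℝ 1 h)
    (hi : Integrable h) (v : EuclideanSpace ℝ (Fin 3))
    (hi' : Integrable fun x => fderiv ℝ h x v) : ∫ x, fderiv ℝ h x v = 0 := by
  have key := integral_bilinear_hasFDerivAt_right_eq_neg_left_of_integrable (μ := volume)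
    (f := fun _ : EuclideanSpace ℝ (Fin 3) => (1 : ℝ))
    (f' := fun _ => (0 : EuclideanSpace ℝ (Fin 3) →L[ℝ] ℝ)) (g := h) (g' := fderiv ℝ h)
    (v := v) (B := ContinuousLinearMap.lsmul ℝ ℝ) ?_ ?_ ?_ ?_ ?_
  · simpa using key
  · simp
  · simpa using hi'
  · simpa using hi
  · intro x _
    exact hasFDerivAt_const _ _
  · intro x _
    exact (hh.differentiable one_ne_zero x).hasFDerivAt

/-- `⟪y, eᵢ⟫ = yᵢ` for the standard basis of `ℝ³`. [folklore] -/
private theorem inner_basisFun (y : EuclideanSpace ℝ (Fin 3)) (i : Fin 3) :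
    ⟪y, EuclideanSpace.basisFun (Fin 3) ℝ i⟫ = y i := by
  rw [EuclideanSpace.basisFun_apply, EuclideanSpace.inner_single_right]; simp

/-- `‖eᵢ‖ = 1`. [folklore] -/
private theorem norm_basisFun (i : Fin 3) : ‖EuclideanSpace.basisFun (Fin 3) ℝ i‖ = 1 :=
  (EuclideanSpace.basisFun (Fin 3) ℝ).orthonormal.1 i

/-- `DU(y)[y] = Σᵢ yᵢ DU(y)[eᵢ]`. [folklore] -/
private theorem fderiv_apply_self_eq_sum (U : EuclideanSpace ℝ (Fin 3) → EuclideanSpace ℝ (Fin 3))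
    (y : EuclideanSpace ℝ (Fin 3)) :
    fderiv ℝ U y y = ∑ i, y i • fderiv ℝ U y (EuclideanSpace.basisFun (Fin 3) ℝ i) := by
  have h : fderiv ℝ U y y = fderiv ℝ U y (∑ i, (EuclideanSpace.basisFun (Fin 3) ℝ).repr y i •
      EuclideanSpace.basisFun (Fin 3) ℝ i) := by rw [OrthonormalBasis.sum_repr]
  rw [h, map_sum]
  exact Finset.sum_congr rfl fun i _ => by rw [map_smul, EuclideanSpace.basisFun_repr]

/-- The second partial `∂ᵥ∂ₑU` as the second derivative: `D(y ↦ DU(y)[e])(y)[v] = D²U(y)[v][e]`.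
[folklore] -/
private theorem fderiv_fderiv_apply_eq {U : EuclideanSpace ℝ (Fin 3) → EuclideanSpace ℝ (Fin 3)}
    (hU : ContDiff ℝ 2 U) (y e v : EuclideanSpace ℝ (Fin 3)) :
    fderiv ℝ (fun z => fderiv ℝ U z e) y v = fderiv ℝ (fderiv ℝ U) y v e := by
  have hd : DifferentiableAt ℝ (fderiv ℝ U) y :=
    ((hU.fderiv_right (m := 1) le_rfl).differentiable one_ne_zero) y
  rw [fderiv_clm_apply hd (differentiableAt_const e)]
  simp

/-- **Lemma 6.2 (i) (p. 19), polarized: `⟨(−Δ + ½ y·∇)U, G⟩_{L²_μ} = Σᵢ ⟨∂ᵢU, ∂ᵢG⟩_{L²_μ}`** for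
`U ∈ C²`, `G ∈ C¹` of polynomial growth (with `DU`, `D²U`, `DG`) — "The operator `−Δ + ½ y·∇` is
self-adjoint on `L²_μ(ℝ³)` and `⟨(−Δ + ½ y·∇)V, V⟩_{L²_μ} = ‖∇V‖²_{L²_μ}`" ("follows by the very
definition of the Gaussian weight `μ`": `∫ ∂ᵢ(γ⟪∂ᵢU, G⟫) = 0` with `∂ᵢγ = −½ yᵢ γ`, summed over `i`).
[cite: PineauVicol2026, Lemma 6.2 (i) (p. 19)] -/
theorem integral_gaussWeight_mul_inner_ou_eq
    {U G : EuclideanSpace ℝ (Fin 3) → EuclideanSpace ℝ (Fin 3)} (hU : ContDiff ℝ 2 U) (hG : ContDiff ℝ 1 G)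
    {C : ℝ} {N : ℕ} (hU1 : ∀ y, ‖fderiv ℝ U y‖ ≤ C * (1 + ‖y‖) ^ N)
    (hU2 : ∀ y, ‖fderiv ℝ (fderiv ℝ U) y‖ ≤ C * (1 + ‖y‖) ^ N)
    (hG0 : ∀ y, ‖G y‖ ≤ C * (1 + ‖y‖) ^ N) (hG1 : ∀ y, ‖fderiv ℝ G y‖ ≤ C * (1 + ‖y‖) ^ N) :
    ∫ y, gaussWeight y * ⟪-(Δ U) y + (1 / 2 : ℝ) • fderiv ℝ U y y, G y⟫ =
      ∫ y, gaussWeight y *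
        ∑ i, ⟪fderiv ℝ U y (EuclideanSpace.basisFun (Fin 3) ℝ i),
          fderiv ℝ G y (EuclideanSpace.basisFun (Fin 3) ℝ i)⟫ := by
  have hC : 0 ≤ C := by
    have := (norm_nonneg (G 0)).trans (hG0 0)
    simpa using this
  have hb0 : ∀ y : EuclideanSpace ℝ (Fin 3), 0 ≤ C * (1 + ‖y‖) ^ N := fun y => by positivity
  have hγ1 : ContDiff ℝ 1 (gaussWeight : EuclideanSpace ℝ (Fin 3) → ℝ) := contDiff_gaussWeight (n := 1)
  -- the partial derivatives `∂ᵢU` are `C¹`, with the bounds of `DU`, `D²U`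
  have hdU : ∀ i, ContDiff ℝ 1 fun y => fderiv ℝ U y (EuclideanSpace.basisFun (Fin 3) ℝ i) := fun i =>
    (hU.fderiv_right (m := 1) le_rfl).clm_apply contDiff_const
  have hU1' : ∀ i y, ‖fderiv ℝ U y (EuclideanSpace.basisFun (Fin 3) ℝ i)‖ ≤ C * (1 + ‖y‖) ^ N :=
    fun i y => (ContinuousLinearMap.le_opNorm _ _).trans (by rw [norm_basisFun, mul_one]; exact hU1 y)
  have hU2' : ∀ i y, ‖fderiv ℝ (fun z => fderiv ℝ U z (EuclideanSpace.basisFun (Fin 3) ℝ i)) y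
      (EuclideanSpace.basisFun (Fin 3) ℝ i)‖ ≤ C * (1 + ‖y‖) ^ N := by
    intro i y
    rw [fderiv_fderiv_apply_eq hU]
    calc ‖fderiv ℝ (fderiv ℝ U) y (EuclideanSpace.basisFun (Fin 3) ℝ i)
          (EuclideanSpace.basisFun (Fin 3) ℝ i)‖
        ≤ ‖fderiv ℝ (fderiv ℝ U) y (EuclideanSpace.basisFun (Fin 3) ℝ i)‖ *
            ‖EuclideanSpace.basisFun (Fin 3) ℝ i‖ := ContinuousLinearMap.le_opNorm _ _
      _ ≤ (‖fderiv ℝ (fderiv ℝ U) y‖ * ‖EuclideanSpace.basisFun (Fin 3) ℝ i‖) *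
            ‖EuclideanSpace.basisFun (Fin 3) ℝ i‖ :=
          mul_le_mul_of_nonneg_right (ContinuousLinearMap.le_opNorm _ _) (norm_nonneg _)
      _ ≤ C * (1 + ‖y‖) ^ N := by rw [norm_basisFun, mul_one, mul_one]; exact hU2 y
  -- the functions `hᵢ = γ ⟪∂ᵢU, G⟫` and their derivatives along `eᵢ`
  have hh : ∀ i, ContDiff ℝ 1 fun y =>
      gaussWeight y * ⟪fderiv ℝ U y (EuclideanSpace.basisFun (Fin 3) ℝ i), G y⟫ := fun i =>
    hγ1.mul ((hdU i).inner ℝ hG)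
  have hDh : ∀ i y, fderiv ℝ (fun y =>
      gaussWeight y * ⟪fderiv ℝ U y (EuclideanSpace.basisFun (Fin 3) ℝ i), G y⟫) y
        (EuclideanSpace.basisFun (Fin 3) ℝ i) =
      -(1 / 2 : ℝ) * (gaussWeight y * (y i * ⟪fderiv ℝ U y (EuclideanSpace.basisFun (Fin 3) ℝ i), G y⟫)) +
        (gaussWeight y * ⟪fderiv ℝ U y (EuclideanSpace.basisFun (Fin 3) ℝ i),
            fderiv ℝ G y (EuclideanSpace.basisFun (Fin 3) ℝ i)⟫ +
          gaussWeight y * ⟪fderiv ℝ (fun z => fderiv ℝ U z (EuclideanSpace.basisFun (Fin 3) ℝ i)) y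
            (EuclideanSpace.basisFun (Fin 3) ℝ i), G y⟫) := by
    intro i y
    have hdγ : DifferentiableAt ℝ gaussWeight y := (hγ1.differentiable one_ne_zero) y
    have hd1 : DifferentiableAt ℝ (fun z => fderiv ℝ U z (EuclideanSpace.basisFun (Fin 3) ℝ i)) y :=
      ((hdU i).differentiable one_ne_zero) y
    have hd2 : DifferentiableAt ℝ G y := (hG.differentiable one_ne_zero) y
    rw [fderiv_fun_mul hdγ (hd1.inner ℝ hd2)]
    simp only [add_apply, smul_apply, smul_eq_mul, fderiv_gaussWeight_apply,
      fderiv_inner_apply ℝ hd1 hd2, inner_basisFun]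
    ring
  -- integrability of `hᵢ` and of the three pieces of `∂ᵢhᵢ`
  have ih : ∀ i, Integrable fun y =>
      gaussWeight y * ⟪fderiv ℝ U y (EuclideanSpace.basisFun (Fin 3) ℝ i), G y⟫ := fun i => by
    refine integrable_gaussWeight_mul_of_norm_le ((hdU i).continuous.inner hG.continuous)
      (C := C ^ 2) (N := 2 * N) fun y => ?_
    calc ‖⟪fderiv ℝ U y (EuclideanSpace.basisFun (Fin 3) ℝ i), G y⟫‖
        ≤ ‖fderiv ℝ U y (EuclideanSpace.basisFun (Fin 3) ℝ i)‖ * ‖G y‖ := norm_inner_le_norm _ _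
      _ ≤ (C * (1 + ‖y‖) ^ N) * (C * (1 + ‖y‖) ^ N) :=
          mul_le_mul (hU1' i y) (hG0 y) (norm_nonneg _) (hb0 y)
      _ = C ^ 2 * (1 + ‖y‖) ^ (2 * N) := by ring
  have iA : ∀ i, Integrable fun y =>
      gaussWeight y * (y i * ⟪fderiv ℝ U y (EuclideanSpace.basisFun (Fin 3) ℝ i), G y⟫) := fun i => by
    have hci : Continuous fun y : EuclideanSpace ℝ (Fin 3) => y i := by fun_prop
    refine integrable_gaussWeight_mul_of_norm_le
      (hci.mul ((hdU i).continuous.inner hG.continuous)) (C := C ^ 2)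
      (N := 2 * N + 1) fun y => ?_
    have hyi : ‖y i‖ ≤ 1 + ‖y‖ := (PiLp.norm_apply_le y i).trans (by linarith [norm_nonneg y])
    rw [norm_mul]
    calc ‖y i‖ * ‖⟪fderiv ℝ U y (EuclideanSpace.basisFun (Fin 3) ℝ i), G y⟫‖
        ≤ (1 + ‖y‖) * (‖fderiv ℝ U y (EuclideanSpace.basisFun (Fin 3) ℝ i)‖ * ‖G y‖) :=
          mul_le_mul hyi (norm_inner_le_norm _ _) (norm_nonneg _) (by positivity)
      _ ≤ (1 + ‖y‖) * ((C * (1 + ‖y‖) ^ N) * (C * (1 + ‖y‖) ^ N)) :=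
          mul_le_mul_of_nonneg_left (mul_le_mul (hU1' i y) (hG0 y) (norm_nonneg _) (hb0 y))
            (by positivity)
      _ = C ^ 2 * (1 + ‖y‖) ^ (2 * N + 1) := by ring
  have iB : ∀ i, Integrable fun y =>
      gaussWeight y * ⟪fderiv ℝ U y (EuclideanSpace.basisFun (Fin 3) ℝ i),
        fderiv ℝ G y (EuclideanSpace.basisFun (Fin 3) ℝ i)⟫ := fun i => by
    refine integrable_gaussWeight_mul_of_norm_le
      ((hdU i).continuous.inner ((hG.continuous_fderiv one_ne_zero).clm_apply continuous_const))
      (C := C ^ 2) (N := 2 * N) fun y => ?_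
    calc ‖⟪fderiv ℝ U y (EuclideanSpace.basisFun (Fin 3) ℝ i),
          fderiv ℝ G y (EuclideanSpace.basisFun (Fin 3) ℝ i)⟫‖
        ≤ ‖fderiv ℝ U y (EuclideanSpace.basisFun (Fin 3) ℝ i)‖ *
            ‖fderiv ℝ G y (EuclideanSpace.basisFun (Fin 3) ℝ i)‖ := norm_inner_le_norm _ _
      _ ≤ (C * (1 + ‖y‖) ^ N) * (C * (1 + ‖y‖) ^ N) :=
          mul_le_mul (hU1' i y) ((ContinuousLinearMap.le_opNorm _ _).trans
            (by rw [norm_basisFun, mul_one]; exact hG1 y)) (norm_nonneg _) (hb0 y)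
      _ = C ^ 2 * (1 + ‖y‖) ^ (2 * N) := by ring
  have iC : ∀ i, Integrable fun y =>
      gaussWeight y * ⟪fderiv ℝ (fun z => fderiv ℝ U z (EuclideanSpace.basisFun (Fin 3) ℝ i)) y
        (EuclideanSpace.basisFun (Fin 3) ℝ i), G y⟫ := fun i => by
    refine integrable_gaussWeight_mul_of_norm_le
      ((((hdU i).continuous_fderiv one_ne_zero).clm_apply continuous_const).inner hG.continuous)
      (C := C ^ 2) (N := 2 * N) fun y => ?_
    calc ‖⟪fderiv ℝ (fun z => fderiv ℝ U z (EuclideanSpace.basisFun (Fin 3) ℝ i)) y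
            (EuclideanSpace.basisFun (Fin 3) ℝ i), G y⟫‖
        ≤ ‖fderiv ℝ (fun z => fderiv ℝ U z (EuclideanSpace.basisFun (Fin 3) ℝ i)) y
            (EuclideanSpace.basisFun (Fin 3) ℝ i)‖ * ‖G y‖ := norm_inner_le_norm _ _
      _ ≤ (C * (1 + ‖y‖) ^ N) * (C * (1 + ‖y‖) ^ N) :=
          mul_le_mul (hU2' i y) (hG0 y) (norm_nonneg _) (hb0 y)
      _ = C ^ 2 * (1 + ‖y‖) ^ (2 * N) := by ring
  -- `∫ ∂ᵢhᵢ = 0` for each `i`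
  have hzero : ∀ i, ∫ y, fderiv ℝ (fun y =>
      gaussWeight y * ⟪fderiv ℝ U y (EuclideanSpace.basisFun (Fin 3) ℝ i), G y⟫) y
        (EuclideanSpace.basisFun (Fin 3) ℝ i) = 0 := fun i => by
    refine integral_fderiv_apply_eq_zero_of_integrable' (hh i) (ih i) _ ?_
    simp_rw [hDh i]
    exact ((iA i).const_mul (-(1 / 2 : ℝ))).add ((iB i).add (iC i))
  simp_rw [hDh] at hzero
  -- evaluate: `∫ ∂ᵢhᵢ = −½ ∫γ yᵢ⟪∂ᵢU, G⟫ + ∫γ⟪∂ᵢU, ∂ᵢG⟫ + ∫γ⟪∂ᵢ∂ᵢU, G⟫`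
  have hsplit : ∀ i, -(1 / 2 : ℝ) * (∫ y, gaussWeight y *
      (y i * ⟪fderiv ℝ U y (EuclideanSpace.basisFun (Fin 3) ℝ i), G y⟫)) +
      ((∫ y, gaussWeight y * ⟪fderiv ℝ U y (EuclideanSpace.basisFun (Fin 3) ℝ i),
          fderiv ℝ G y (EuclideanSpace.basisFun (Fin 3) ℝ i)⟫) +
        ∫ y, gaussWeight y * ⟪fderiv ℝ (fun z => fderiv ℝ U z (EuclideanSpace.basisFun (Fin 3) ℝ i)) y
          (EuclideanSpace.basisFun (Fin 3) ℝ i), G y⟫) = 0 := by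
    intro i
    have h := hzero i
    have i1 : Integrable fun y => -(1 / 2 : ℝ) * (gaussWeight y *
        (y i * ⟪fderiv ℝ U y (EuclideanSpace.basisFun (Fin 3) ℝ i), G y⟫)) := (iA i).const_mul _
    have i23 : Integrable fun y =>
        gaussWeight y * ⟪fderiv ℝ U y (EuclideanSpace.basisFun (Fin 3) ℝ i),
            fderiv ℝ G y (EuclideanSpace.basisFun (Fin 3) ℝ i)⟫ +
          gaussWeight y * ⟪fderiv ℝ (fun z => fderiv ℝ U z (EuclideanSpace.basisFun (Fin 3) ℝ i)) y
            (EuclideanSpace.basisFun (Fin 3) ℝ i), G y⟫ := (iB i).add (iC i)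
    rw [integral_add i1 i23, integral_add (iB i) (iC i), integral_const_mul] at h
    linarith
  -- sum over `i` and identify the three sums
  have hsumA : ∑ i, ∫ y, gaussWeight y *
      (y i * ⟪fderiv ℝ U y (EuclideanSpace.basisFun (Fin 3) ℝ i), G y⟫) =
      ∫ y, gaussWeight y * ⟪fderiv ℝ U y y, G y⟫ := by
    rw [← integral_finsetSum _ fun i _ => iA i]
    refine integral_congr_ae (Eventually.of_forall fun y => ?_)
    simp only [fderiv_apply_self_eq_sum U y, sum_inner, real_inner_smul_left, Finset.mul_sum]
  have hsumC : ∑ i, ∫ y, gaussWeight y *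
      ⟪fderiv ℝ (fun z => fderiv ℝ U z (EuclideanSpace.basisFun (Fin 3) ℝ i)) y
        (EuclideanSpace.basisFun (Fin 3) ℝ i), G y⟫ = ∫ y, gaussWeight y * ⟪(Δ U) y, G y⟫ := by
    rw [← integral_finsetSum _ fun i _ => iC i]
    refine integral_congr_ae (Eventually.of_forall fun y => ?_)
    simp only [laplacian_eq_sum_fderiv_fderiv (EuclideanSpace.basisFun (Fin 3) ℝ) hU y, sum_inner,
      Finset.mul_sum]
  have hsumB : ∑ i, ∫ y, gaussWeight y * ⟪fderiv ℝ U y (EuclideanSpace.basisFun (Fin 3) ℝ i),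
      fderiv ℝ G y (EuclideanSpace.basisFun (Fin 3) ℝ i)⟫ =
      ∫ y, gaussWeight y * ∑ i, ⟪fderiv ℝ U y (EuclideanSpace.basisFun (Fin 3) ℝ i),
        fderiv ℝ G y (EuclideanSpace.basisFun (Fin 3) ℝ i)⟫ := by
    rw [← integral_finsetSum _ fun i _ => iB i]
    refine integral_congr_ae (Eventually.of_forall fun y => ?_)
    simp only [Finset.mul_sum]
  have htot : -(1 / 2 : ℝ) * (∫ y, gaussWeight y * ⟪fderiv ℝ U y y, G y⟫) +
      ((∫ y, gaussWeight y * ∑ i, ⟪fderiv ℝ U y (EuclideanSpace.basisFun (Fin 3) ℝ i),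
          fderiv ℝ G y (EuclideanSpace.basisFun (Fin 3) ℝ i)⟫) +
        ∫ y, gaussWeight y * ⟪(Δ U) y, G y⟫) = 0 := by
    rw [← hsumA, ← hsumB, ← hsumC]
    have := Finset.sum_eq_zero (s := (Finset.univ : Finset (Fin 3))) fun i _ => hsplit i
    simpa [Finset.sum_add_distrib, Finset.mul_sum] using this
  -- the left-hand side, split
  have iL1 : Integrable fun y => gaussWeight y * ⟪(Δ U) y, G y⟫ := by
    have e : (fun y => gaussWeight y * ⟪(Δ U) y, G y⟫) = fun y => ∑ i, gaussWeight y *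
        ⟪fderiv ℝ (fun z => fderiv ℝ U z (EuclideanSpace.basisFun (Fin 3) ℝ i)) y
          (EuclideanSpace.basisFun (Fin 3) ℝ i), G y⟫ := by
      funext y
      simp only [laplacian_eq_sum_fderiv_fderiv (EuclideanSpace.basisFun (Fin 3) ℝ) hU y, sum_inner,
        Finset.mul_sum]
    rw [e]; exact integrable_finsetSum _ fun i _ => iC i
  have iL2 : Integrable fun y => gaussWeight y * ⟪fderiv ℝ U y y, G y⟫ := by
    have e : (fun y => gaussWeight y * ⟪fderiv ℝ U y y, G y⟫) = fun y => ∑ i, gaussWeight y *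
        (y i * ⟪fderiv ℝ U y (EuclideanSpace.basisFun (Fin 3) ℝ i), G y⟫) := by
      funext y
      simp only [fderiv_apply_self_eq_sum U y, sum_inner, real_inner_smul_left, Finset.mul_sum]
    rw [e]; exact integrable_finsetSum _ fun i _ => iA i
  have eL : (fun y => gaussWeight y * ⟪-(Δ U) y + (1 / 2 : ℝ) • fderiv ℝ U y y, G y⟫) = fun y =>
      -(gaussWeight y * ⟪(Δ U) y, G y⟫) + (1 / 2 : ℝ) * (gaussWeight y * ⟪fderiv ℝ U y y, G y⟫) := by
    funext y; rw [inner_add_left, inner_neg_left, real_inner_smul_left]; ring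
  have iL1n : Integrable fun y => -(gaussWeight y * ⟪(Δ U) y, G y⟫) := iL1.neg
  have iL2c : Integrable fun y => (1 / 2 : ℝ) * (gaussWeight y * ⟪fderiv ℝ U y y, G y⟫) :=
    iL2.const_mul _
  rw [eL, integral_add iL1n iL2c, integral_neg, integral_const_mul]
  linarith

/-- **Lemma 6.2 (i), as printed (diagonal case): `⟨(−Δ + ½ y·∇)U, U⟩_{L²_μ} = ‖∇U‖²_{L²_μ}`**,
`‖∇U‖² = Σᵢ |∂ᵢU|²`, for `U ∈ C²` of polynomial growth. [cite: PineauVicol2026, Lemma 6.2 (i) (p. 19)] -/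
theorem integral_gaussWeight_mul_inner_ou_self
    {U : EuclideanSpace ℝ (Fin 3) → EuclideanSpace ℝ (Fin 3)} (hU : ContDiff ℝ 2 U)
    {C : ℝ} {N : ℕ} (hU0 : ∀ y, ‖U y‖ ≤ C * (1 + ‖y‖) ^ N) (hU1 : ∀ y, ‖fderiv ℝ U y‖ ≤ C * (1 + ‖y‖) ^ N)
    (hU2 : ∀ y, ‖fderiv ℝ (fderiv ℝ U) y‖ ≤ C * (1 + ‖y‖) ^ N) :
    ∫ y, gaussWeight y * ⟪-(Δ U) y + (1 / 2 : ℝ) • fderiv ℝ U y y, U y⟫ =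
      ∫ y, gaussWeight y * ∑ i, ‖fderiv ℝ U y (EuclideanSpace.basisFun (Fin 3) ℝ i)‖ ^ 2 := by
  rw [integral_gaussWeight_mul_inner_ou_eq hU (hU.of_le one_le_two) hU1 hU2 hU0 hU1]
  simp_rw [real_inner_self_eq_norm_sq]


/-! ### The commutation step: `⟨(−Δ + ½ y·∇)U, 𝓡U⟩_{L²_γ} = 0` -/

/-- `‖J‖ ≤ 1` as an operator. [folklore] -/
private theorem norm_rotGenL_le : ‖rotGenL‖ ≤ 1 :=
  ContinuousLinearMap.opNorm_le_bound _ zero_le_one fun v => by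
    rw [rotGenL_apply, one_mul]; exact norm_rotGen_le v

/-- The derivative of `𝓡U = J∘U − DU[J·]` for `U ∈ C²`:
`D(𝓡U)(y) = J ∘ DU(y) − (DU(y) ∘ J + (D²U(y) ·)[Jy])`. [folklore] -/
private theorem hasFDerivAt_rotOp {U : EuclideanSpace ℝ (Fin 3) → EuclideanSpace ℝ (Fin 3)}
    (hU : ContDiff ℝ 2 U) (y : EuclideanSpace ℝ (Fin 3)) :
    HasFDerivAt (fun z => rotGen (U z) - fderiv ℝ U z (rotGen z))
      (rotGenL.comp (fderiv ℝ U y) -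
        ((fderiv ℝ U y).comp rotGenL + (fderiv ℝ (fderiv ℝ U) y).flip (rotGen y))) y := by
  have hd : DifferentiableAt ℝ U y := (hU.differentiable (by norm_num)) y
  have hdd : DifferentiableAt ℝ (fderiv ℝ U) y :=
    ((hU.fderiv_right (m := 1) le_rfl).differentiable one_ne_zero) y
  have h1 : HasFDerivAt (fun z => rotGen (U z)) (rotGenL.comp (fderiv ℝ U y)) y := by
    have := rotGenL.hasFDerivAt.comp y hd.hasFDerivAt
    simpa [Function.comp_def] using this
  exact h1.sub (hdd.hasFDerivAt.clm_apply (hasFDerivAt_rotGen y))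

/-- `Σᵢ ⟪DU(y)[eᵢ], DU(y)[J eᵢ]⟫ = ⟪∂₀U, ∂₁U⟫ − ⟪∂₁U, ∂₀U⟫ = 0`: a skew generator pairs the
(symmetric) Gram matrix of the gradient to zero. [folklore] -/
private theorem sum_inner_fderiv_rotGen_basis (U : EuclideanSpace ℝ (Fin 3) → EuclideanSpace ℝ (Fin 3))
    (y : EuclideanSpace ℝ (Fin 3)) :
    ∑ i, ⟪fderiv ℝ U y (EuclideanSpace.basisFun (Fin 3) ℝ i),
      fderiv ℝ U y (rotGen (EuclideanSpace.basisFun (Fin 3) ℝ i))⟫ = 0 := by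
  simp only [Fin.sum_univ_three, EuclideanSpace.basisFun_apply, rotGen_single_zero,
    rotGen_single_one, rotGen_single_two, map_neg, map_zero, inner_neg_right, inner_zero_right]
  rw [real_inner_comm]; ring

/-- **The commutation step of the proof of Lemma 6.4 (p. 21):
`⟨𝓡U, (−Δ + ½ y·∇)U⟩_{L²_μ} = 0`** ("the operators `𝓡` and `−Δ + ½ y·∇` commute … `𝓡` is
skew-adjoint on `L²_μ`, whereas `−Δ + ½ y·∇` is self-adjoint. Combined, these facts yield …"), for
`U ∈ C²` of polynomial growth. Proved here directly: by the polarized Lemma 6.2 (i) the pairing is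
`Σᵢ ⟨∂ᵢU, ∂ᵢ(𝓡U)⟩_γ` with `∂ᵢ(𝓡U) = J∂ᵢU − DU[Jeᵢ] − D²U[eᵢ][Jy]`; the first term pairs to zero
pointwise (`J` skew), the second sums to zero over `i` (`J` skew against the symmetric Gram matrix),
and the third is `D(∂ᵢU)[Jy]` by the symmetry of `D²U`, whose pairing with `∂ᵢU` integrates to
zero by angular transport. [cite: PineauVicol2026, proof of Lemma 6.4 (p. 21)] -/
theorem integral_gaussWeight_mul_inner_ou_rotOp_eq_zero
    {U : EuclideanSpace ℝ (Fin 3) → EuclideanSpace ℝ (Fin 3)} (hU : ContDiff ℝ 2 U)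
    {C : ℝ} {N : ℕ} (hU0 : ∀ y, ‖U y‖ ≤ C * (1 + ‖y‖) ^ N) (hU1 : ∀ y, ‖fderiv ℝ U y‖ ≤ C * (1 + ‖y‖) ^ N)
    (hU2 : ∀ y, ‖fderiv ℝ (fderiv ℝ U) y‖ ≤ C * (1 + ‖y‖) ^ N) :
    ∫ y, gaussWeight y * ⟪-(Δ U) y + (1 / 2 : ℝ) • fderiv ℝ U y y,
      rotGen (U y) - fderiv ℝ U y (rotGen y)⟫ = 0 := by
  have hC : 0 ≤ C := by
    have := (norm_nonneg (U 0)).trans (hU0 0)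
    simpa using this
  have hb0 : ∀ y : EuclideanSpace ℝ (Fin 3), 0 ≤ C * (1 + ‖y‖) ^ N := fun y => by positivity
  have hy1 : ∀ y : EuclideanSpace ℝ (Fin 3), ‖rotGen y‖ ≤ 1 + ‖y‖ := fun y =>
    (norm_rotGen_le y).trans (by linarith [norm_nonneg y])
  have hone : ∀ y : EuclideanSpace ℝ (Fin 3), (1 : ℝ) ≤ 1 + ‖y‖ := fun y => by linarith [norm_nonneg y]
  -- enlarge the bounds of `U` to `3C (1+|y|)^(N+1)`, which also bound `𝓡U` and `D(𝓡U)`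
  have hup : ∀ y : EuclideanSpace ℝ (Fin 3), C * (1 + ‖y‖) ^ N ≤ 3 * C * (1 + ‖y‖) ^ (N + 1) := by
    intro y
    have h1 : (1 + ‖y‖) ^ N ≤ (1 + ‖y‖) ^ (N + 1) := pow_le_pow_right₀ (hone y) (Nat.le_succ N)
    nlinarith [hb0 y, mul_le_mul_of_nonneg_left h1 hC, pow_nonneg (zero_le_one.trans (hone y)) (N + 1)]
  -- `𝓡U` is `C¹` with polynomial bounds
  have hG : ContDiff ℝ 1 fun z => rotGen (U z) - fderiv ℝ U z (rotGen z) :=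
    ((contDiff_rotGen' (n := 1)).comp (hU.of_le one_le_two)).sub
      ((hU.fderiv_right (m := 1) le_rfl).clm_apply (contDiff_rotGen' (n := 1)))
  have hG0 : ∀ y, ‖rotGen (U y) - fderiv ℝ U y (rotGen y)‖ ≤ 3 * C * (1 + ‖y‖) ^ (N + 1) := by
    intro y
    calc ‖rotGen (U y) - fderiv ℝ U y (rotGen y)‖
        ≤ ‖rotGen (U y)‖ + ‖fderiv ℝ U y (rotGen y)‖ := norm_sub_le _ _
      _ ≤ C * (1 + ‖y‖) ^ N + C * (1 + ‖y‖) ^ N * (1 + ‖y‖) := by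
          refine add_le_add ((norm_rotGen_le _).trans (hU0 y)) ?_
          exact (ContinuousLinearMap.le_opNorm _ _).trans
            (mul_le_mul (hU1 y) (hy1 y) (norm_nonneg _) (hb0 y))
      _ ≤ 3 * C * (1 + ‖y‖) ^ (N + 1) := by
          have h1 : (1 + ‖y‖) ^ N ≤ (1 + ‖y‖) ^ (N + 1) := pow_le_pow_right₀ (hone y) (Nat.le_succ N)
          have h2 : C * (1 + ‖y‖) ^ N * (1 + ‖y‖) = C * (1 + ‖y‖) ^ (N + 1) := by ring
          nlinarith [mul_le_mul_of_nonneg_left h1 hC, hb0 y,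
            pow_nonneg (zero_le_one.trans (hone y)) (N + 1)]
  have hG1 : ∀ y, ‖fderiv ℝ (fun z => rotGen (U z) - fderiv ℝ U z (rotGen z)) y‖ ≤
      3 * C * (1 + ‖y‖) ^ (N + 1) := by
    intro y
    rw [(hasFDerivAt_rotOp hU y).fderiv]
    have hJU : ‖rotGenL.comp (fderiv ℝ U y)‖ ≤ C * (1 + ‖y‖) ^ N :=
      (ContinuousLinearMap.opNorm_comp_le _ _).trans
        ((mul_le_mul norm_rotGenL_le (hU1 y) (norm_nonneg _) zero_le_one).trans (by rw [one_mul]))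
    have hUJ : ‖(fderiv ℝ U y).comp rotGenL‖ ≤ C * (1 + ‖y‖) ^ N :=
      (ContinuousLinearMap.opNorm_comp_le _ _).trans
        ((mul_le_mul (hU1 y) norm_rotGenL_le (norm_nonneg _) (hb0 y)).trans (by rw [mul_one]))
    have hflip : ‖(fderiv ℝ (fderiv ℝ U) y).flip (rotGen y)‖ ≤ C * (1 + ‖y‖) ^ N * (1 + ‖y‖) := by
      calc ‖(fderiv ℝ (fderiv ℝ U) y).flip (rotGen y)‖
          ≤ ‖(fderiv ℝ (fderiv ℝ U) y).flip‖ * ‖rotGen y‖ := ContinuousLinearMap.le_opNorm _ _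
        _ = ‖fderiv ℝ (fderiv ℝ U) y‖ * ‖rotGen y‖ := by rw [ContinuousLinearMap.opNorm_flip]
        _ ≤ C * (1 + ‖y‖) ^ N * (1 + ‖y‖) := mul_le_mul (hU2 y) (hy1 y) (norm_nonneg _) (hb0 y)
    calc ‖rotGenL.comp (fderiv ℝ U y) -
          ((fderiv ℝ U y).comp rotGenL + (fderiv ℝ (fderiv ℝ U) y).flip (rotGen y))‖
        ≤ ‖rotGenL.comp (fderiv ℝ U y)‖ +
            ‖(fderiv ℝ U y).comp rotGenL + (fderiv ℝ (fderiv ℝ U) y).flip (rotGen y)‖ := norm_sub_le _ _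
      _ ≤ ‖rotGenL.comp (fderiv ℝ U y)‖ +
            (‖(fderiv ℝ U y).comp rotGenL‖ + ‖(fderiv ℝ (fderiv ℝ U) y).flip (rotGen y)‖) :=
          add_le_add le_rfl (norm_add_le _ _)
      _ ≤ C * (1 + ‖y‖) ^ N + (C * (1 + ‖y‖) ^ N + C * (1 + ‖y‖) ^ N * (1 + ‖y‖)) :=
          add_le_add hJU (add_le_add hUJ hflip)
      _ ≤ 3 * C * (1 + ‖y‖) ^ (N + 1) := by
          have h1 : (1 + ‖y‖) ^ N ≤ (1 + ‖y‖) ^ (N + 1) := pow_le_pow_right₀ (hone y) (Nat.le_succ N)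
          have h2 : C * (1 + ‖y‖) ^ N * (1 + ‖y‖) = C * (1 + ‖y‖) ^ (N + 1) := by ring
          nlinarith [mul_le_mul_of_nonneg_left h1 hC, hb0 y]
  -- Lemma 6.2 (i), polarized, with `G = 𝓡U`
  rw [integral_gaussWeight_mul_inner_ou_eq hU hG (C := 3 * C) (N := N + 1)
    (fun y => (hU1 y).trans (hup y)) (fun y => (hU2 y).trans (hup y)) hG0 hG1]
  -- the partial derivatives `∂ᵢ(𝓡U)` and the pointwise reduction of the integrand
  have hsymm : ∀ y (v w : EuclideanSpace ℝ (Fin 3)),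
      fderiv ℝ (fderiv ℝ U) y v w = fderiv ℝ (fderiv ℝ U) y w v := fun y v w =>
    ((hU.contDiffAt (x := y)).isSymmSndFDerivAt (by simp)).eq v w
  have hDG : ∀ y i, fderiv ℝ (fun z => rotGen (U z) - fderiv ℝ U z (rotGen z)) y
      (EuclideanSpace.basisFun (Fin 3) ℝ i) =
      rotGen (fderiv ℝ U y (EuclideanSpace.basisFun (Fin 3) ℝ i)) -
        (fderiv ℝ U y (rotGen (EuclideanSpace.basisFun (Fin 3) ℝ i)) +
          fderiv ℝ (fun z => fderiv ℝ U z (EuclideanSpace.basisFun (Fin 3) ℝ i)) y (rotGen y)) := by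
    intro y i
    rw [(hasFDerivAt_rotOp hU y).fderiv, fderiv_fderiv_apply_eq hU, hsymm y (rotGen y)]
    simp only [sub_apply, add_apply, ContinuousLinearMap.comp_apply,
      rotGenL_apply, ContinuousLinearMap.flip_apply]
  have hpt : ∀ y, ∑ i, ⟪fderiv ℝ U y (EuclideanSpace.basisFun (Fin 3) ℝ i),
      fderiv ℝ (fun z => rotGen (U z) - fderiv ℝ U z (rotGen z)) y (EuclideanSpace.basisFun (Fin 3) ℝ i)⟫ =
      -∑ i, ⟪fderiv ℝ (fun z => fderiv ℝ U z (EuclideanSpace.basisFun (Fin 3) ℝ i)) y (rotGen y),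
        fderiv ℝ U y (EuclideanSpace.basisFun (Fin 3) ℝ i)⟫ := by
    intro y
    have h0 := sum_inner_fderiv_rotGen_basis U y
    simp only [hDG, inner_sub_right, inner_add_right, inner_rotGen_self_right, zero_sub,
      Finset.sum_neg_distrib, Finset.sum_add_distrib, neg_add, h0, neg_zero, zero_add]
    refine congr_arg _ (Finset.sum_congr rfl fun i _ => real_inner_comm _ _)
  simp_rw [hpt]
  -- the partial derivatives `∂ᵢU` are `C¹` with the bounds of `DU`, `D²U`
  have hdU : ∀ i, ContDiff ℝ 1 fun y => fderiv ℝ U y (EuclideanSpace.basisFun (Fin 3) ℝ i) := fun i =>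
    (hU.fderiv_right (m := 1) le_rfl).clm_apply contDiff_const
  have hV0 : ∀ i y, ‖fderiv ℝ U y (EuclideanSpace.basisFun (Fin 3) ℝ i)‖ ≤ C * (1 + ‖y‖) ^ N :=
    fun i y => (ContinuousLinearMap.le_opNorm _ _).trans (by rw [norm_basisFun, mul_one]; exact hU1 y)
  have hV1 : ∀ i y, ‖fderiv ℝ (fun z => fderiv ℝ U z (EuclideanSpace.basisFun (Fin 3) ℝ i)) y‖ ≤
      C * (1 + ‖y‖) ^ N := by
    intro i y
    refine ContinuousLinearMap.opNorm_le_bound _ (hb0 y) fun v => ?_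
    rw [fderiv_fderiv_apply_eq hU]
    calc ‖fderiv ℝ (fderiv ℝ U) y v (EuclideanSpace.basisFun (Fin 3) ℝ i)‖
        ≤ ‖fderiv ℝ (fderiv ℝ U) y v‖ * ‖EuclideanSpace.basisFun (Fin 3) ℝ i‖ :=
          ContinuousLinearMap.le_opNorm _ _
      _ ≤ (‖fderiv ℝ (fderiv ℝ U) y‖ * ‖v‖) * 1 := by
          rw [norm_basisFun]
          exact mul_le_mul_of_nonneg_right (ContinuousLinearMap.le_opNorm _ _) zero_le_one
      _ ≤ C * (1 + ‖y‖) ^ N * ‖v‖ := by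
          rw [mul_one]; exact mul_le_mul_of_nonneg_right (hU2 y) (norm_nonneg _)
  have hzero : ∀ i, ∫ y, gaussWeight y *
      ⟪fderiv ℝ (fun z => fderiv ℝ U z (EuclideanSpace.basisFun (Fin 3) ℝ i)) y (rotGen y),
        fderiv ℝ U y (EuclideanSpace.basisFun (Fin 3) ℝ i)⟫ = 0 := fun i =>
    integral_gaussWeight_mul_inner_fderiv_rotGen_self_eq_zero (hdU i) (hV0 i) (hV1 i)
  have iI : ∀ i, Integrable fun y => gaussWeight y *
      ⟪fderiv ℝ (fun z => fderiv ℝ U z (EuclideanSpace.basisFun (Fin 3) ℝ i)) y (rotGen y),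
        fderiv ℝ U y (EuclideanSpace.basisFun (Fin 3) ℝ i)⟫ := fun i => by
    refine integrable_gaussWeight_mul_of_norm_le
      ((((hdU i).continuous_fderiv one_ne_zero).clm_apply (contDiff_rotGen' (n := 1)).continuous).inner
        (hdU i).continuous) (C := C ^ 2) (N := 2 * N + 1) fun y => ?_
    calc ‖⟪fderiv ℝ (fun z => fderiv ℝ U z (EuclideanSpace.basisFun (Fin 3) ℝ i)) y (rotGen y),
          fderiv ℝ U y (EuclideanSpace.basisFun (Fin 3) ℝ i)⟫‖
        ≤ ‖fderiv ℝ (fun z => fderiv ℝ U z (EuclideanSpace.basisFun (Fin 3) ℝ i)) y (rotGen y)‖ *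
            ‖fderiv ℝ U y (EuclideanSpace.basisFun (Fin 3) ℝ i)‖ := norm_inner_le_norm _ _
      _ ≤ (C * (1 + ‖y‖) ^ N * (1 + ‖y‖)) * (C * (1 + ‖y‖) ^ N) :=
          mul_le_mul ((ContinuousLinearMap.le_opNorm _ _).trans
            (mul_le_mul (hV1 i y) (hy1 y) (norm_nonneg _) (hb0 y))) (hV0 i y) (norm_nonneg _)
            (by positivity)
      _ = C ^ 2 * (1 + ‖y‖) ^ (2 * N + 1) := by ring
  have e : (fun y => gaussWeight y * -∑ i,
      ⟪fderiv ℝ (fun z => fderiv ℝ U z (EuclideanSpace.basisFun (Fin 3) ℝ i)) y (rotGen y),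
        fderiv ℝ U y (EuclideanSpace.basisFun (Fin 3) ℝ i)⟫) = fun y => -∑ i, gaussWeight y *
      ⟪fderiv ℝ (fun z => fderiv ℝ U z (EuclideanSpace.basisFun (Fin 3) ℝ i)) y (rotGen y),
        fderiv ℝ U y (EuclideanSpace.basisFun (Fin 3) ℝ i)⟫ := by
    funext y; rw [mul_neg, Finset.mul_sum]
  rw [e, integral_neg, integral_finsetSum _ fun i _ => iI i, Finset.sum_eq_zero fun i _ => hzero i,
    neg_zero]

/-! ### (6.18): the angular energy identity -/

/-- Pointwise `‖ΔU(y)‖ ≤ 3 ‖D²U(y)‖` in dimension three. [folklore] -/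
private theorem norm_laplacian_le {U : EuclideanSpace ℝ (Fin 3) → EuclideanSpace ℝ (Fin 3)}
    (hU : ContDiff ℝ 2 U) (y : EuclideanSpace ℝ (Fin 3)) :
    ‖(Δ U) y‖ ≤ 3 * ‖fderiv ℝ (fderiv ℝ U) y‖ := by
  rw [laplacian_eq_sum_fderiv_fderiv (EuclideanSpace.basisFun (Fin 3) ℝ) hU y]
  calc ‖∑ i, fderiv ℝ (fun z => fderiv ℝ U z (EuclideanSpace.basisFun (Fin 3) ℝ i)) y
        (EuclideanSpace.basisFun (Fin 3) ℝ i)‖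
      ≤ ∑ i, ‖fderiv ℝ (fun z => fderiv ℝ U z (EuclideanSpace.basisFun (Fin 3) ℝ i)) y
        (EuclideanSpace.basisFun (Fin 3) ℝ i)‖ := norm_sum_le _ _
    _ ≤ ∑ _i : Fin 3, ‖fderiv ℝ (fderiv ℝ U) y‖ := Finset.sum_le_sum fun i _ => by
        rw [fderiv_fderiv_apply_eq hU]
        calc ‖fderiv ℝ (fderiv ℝ U) y (EuclideanSpace.basisFun (Fin 3) ℝ i)
              (EuclideanSpace.basisFun (Fin 3) ℝ i)‖
            ≤ ‖fderiv ℝ (fderiv ℝ U) y (EuclideanSpace.basisFun (Fin 3) ℝ i)‖ *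
                ‖EuclideanSpace.basisFun (Fin 3) ℝ i‖ := ContinuousLinearMap.le_opNorm _ _
          _ ≤ (‖fderiv ℝ (fderiv ℝ U) y‖ * ‖EuclideanSpace.basisFun (Fin 3) ℝ i‖) *
                ‖EuclideanSpace.basisFun (Fin 3) ℝ i‖ :=
              mul_le_mul_of_nonneg_right (ContinuousLinearMap.le_opNorm _ _) (norm_nonneg _)
          _ = ‖fderiv ℝ (fderiv ℝ U) y‖ := by rw [norm_basisFun, mul_one, mul_one]
    _ = 3 * ‖fderiv ℝ (fderiv ℝ U) y‖ := by rw [Fin.sum_univ_three]; ring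

/-- Pointwise bound on `𝓡U = JU − DU[Jy]` from polynomial bounds on `U`, `DU`. [folklore] -/
private theorem norm_rotOp_le {U : EuclideanSpace ℝ (Fin 3) → EuclideanSpace ℝ (Fin 3)}
    {C : ℝ} {N : ℕ} (hU0 : ∀ y, ‖U y‖ ≤ C * (1 + ‖y‖) ^ N)
    (hU1 : ∀ y, ‖fderiv ℝ U y‖ ≤ C * (1 + ‖y‖) ^ N) (y : EuclideanSpace ℝ (Fin 3)) :
    ‖rotGen (U y) - fderiv ℝ U y (rotGen y)‖ ≤ 2 * C * (1 + ‖y‖) ^ (N + 1) := by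
  have hC : 0 ≤ C := by
    have := (norm_nonneg (U 0)).trans (hU0 0)
    simpa using this
  have hone : (1 : ℝ) ≤ 1 + ‖y‖ := by linarith [norm_nonneg y]
  have hb0 : 0 ≤ C * (1 + ‖y‖) ^ N := by positivity
  have h1 : C * (1 + ‖y‖) ^ N ≤ C * (1 + ‖y‖) ^ (N + 1) :=
    mul_le_mul_of_nonneg_left (pow_le_pow_right₀ hone (Nat.le_succ N)) hC
  calc ‖rotGen (U y) - fderiv ℝ U y (rotGen y)‖
      ≤ ‖rotGen (U y)‖ + ‖fderiv ℝ U y (rotGen y)‖ := norm_sub_le _ _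
    _ ≤ C * (1 + ‖y‖) ^ N + C * (1 + ‖y‖) ^ N * (1 + ‖y‖) := by
        refine add_le_add ((norm_rotGen_le _).trans (hU0 y)) ?_
        exact (ContinuousLinearMap.le_opNorm _ _).trans (mul_le_mul (hU1 y)
          ((norm_rotGen_le y).trans (by linarith [norm_nonneg y])) (norm_nonneg _) hb0)
    _ = C * (1 + ‖y‖) ^ N + C * (1 + ‖y‖) ^ (N + 1) := by ring
    _ ≤ 2 * C * (1 + ‖y‖) ^ (N + 1) := by linarith

/-- **(6.18), unsigned form: `α ‖𝓡U‖²_{L²_μ} = ⟨𝓡U, 𝓝⟩_{L²_μ}`** for a `C²` solution of polynomial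
growth (with `DU`, `D²U`) of the rotated profile system (6.16a) = (1.8),
`α(JU − DU[Jy]) + ½U + ½DU[y] − ΔU + (U·∇)U + ∇P = 0`, with `𝓝 := −(U·∇)U − ∇P`: take the `L²_γ`
pairing of (6.16a) with `𝓡U` and use `⟨𝓡U, U⟩_γ = 0`, `⟨𝓡U, (−Δ + ½y·∇)U⟩_γ = 0`.
[cite: PineauVicol2026, (6.18) (p. 21)] -/
theorem mul_integral_gaussWeight_mul_norm_rotOp_sq
    {U : EuclideanSpace ℝ (Fin 3) → EuclideanSpace ℝ (Fin 3)} {P : EuclideanSpace ℝ (Fin 3) → ℝ} {α : ℝ}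
    (hU : ContDiff ℝ 2 U) {C : ℝ} {N : ℕ} (hU0 : ∀ y, ‖U y‖ ≤ C * (1 + ‖y‖) ^ N)
    (hU1 : ∀ y, ‖fderiv ℝ U y‖ ≤ C * (1 + ‖y‖) ^ N)
    (hU2 : ∀ y, ‖fderiv ℝ (fderiv ℝ U) y‖ ≤ C * (1 + ‖y‖) ^ N)
    (heq : ∀ y, α • (rotGen (U y) - fderiv ℝ U y (rotGen y)) + (1 / 2 : ℝ) • U y +
      (1 / 2 : ℝ) • fderiv ℝ U y y - (Δ U) y + convect U U y + gradient P y = 0) :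
    α * ∫ y, gaussWeight y * ‖rotGen (U y) - fderiv ℝ U y (rotGen y)‖ ^ 2 =
      ∫ y, gaussWeight y * ⟪rotGen (U y) - fderiv ℝ U y (rotGen y), -(convect U U y) - gradient P y⟫ := by
  have hC : 0 ≤ C := by
    have := (norm_nonneg (U 0)).trans (hU0 0)
    simpa using this
  have hb0 : ∀ y : EuclideanSpace ℝ (Fin 3), 0 ≤ C * (1 + ‖y‖) ^ N := fun y => by positivity
  -- from (6.16a): `𝓝 = α 𝓡U + ½ U + (−ΔU + ½ DU[y])`
  have hN : ∀ y, -(convect U U y) - gradient P y = α • (rotGen (U y) - fderiv ℝ U y (rotGen y)) +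
      (1 / 2 : ℝ) • U y + (-(Δ U) y + (1 / 2 : ℝ) • fderiv ℝ U y y) := fun y => by
    have h := heq y
    rw [eq_comm, ← sub_eq_zero, ← h]
    abel
  have e : (fun y => gaussWeight y *
      ⟪rotGen (U y) - fderiv ℝ U y (rotGen y), -(convect U U y) - gradient P y⟫) = fun y =>
      gaussWeight y * (α * ‖rotGen (U y) - fderiv ℝ U y (rotGen y)‖ ^ 2) +
        gaussWeight y * ((1 / 2 : ℝ) * ⟪rotGen (U y) - fderiv ℝ U y (rotGen y), U y⟫) +
        gaussWeight y * ⟪rotGen (U y) - fderiv ℝ U y (rotGen y),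
          -(Δ U) y + (1 / 2 : ℝ) • fderiv ℝ U y y⟫ := by
    funext y
    rw [hN y]
    simp only [inner_add_right, real_inner_smul_right, real_inner_self_eq_norm_sq]
    ring
  rw [e]
  -- integrability of the three pieces
  have hR0 : ∀ y, ‖rotGen (U y) - fderiv ℝ U y (rotGen y)‖ ≤ 2 * C * (1 + ‖y‖) ^ (N + 1) :=
    norm_rotOp_le hU0 hU1
  have hRc : Continuous fun y => rotGen (U y) - fderiv ℝ U y (rotGen y) :=
    ((contDiff_rotGen' (n := 1)).continuous.comp hU.continuous).sub
      ((hU.continuous_fderiv (by norm_num)).clm_apply (contDiff_rotGen' (n := 1)).continuous)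
  have i1 : Integrable fun y => gaussWeight y * (α * ‖rotGen (U y) - fderiv ℝ U y (rotGen y)‖ ^ 2) := by
    refine integrable_gaussWeight_mul_of_norm_le (continuous_const.mul (hRc.norm.pow 2))
      (C := ‖α‖ * (2 * C) ^ 2) (N := 2 * (N + 1)) fun y => ?_
    rw [norm_mul, norm_pow, norm_norm]
    calc ‖α‖ * ‖rotGen (U y) - fderiv ℝ U y (rotGen y)‖ ^ 2
        ≤ ‖α‖ * (2 * C * (1 + ‖y‖) ^ (N + 1)) ^ 2 :=
          mul_le_mul_of_nonneg_left (pow_le_pow_left₀ (norm_nonneg _) (hR0 y) 2) (norm_nonneg _)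
      _ = ‖α‖ * (2 * C) ^ 2 * (1 + ‖y‖) ^ (2 * (N + 1)) := by ring
  have i2 : Integrable fun y => gaussWeight y *
      ((1 / 2 : ℝ) * ⟪rotGen (U y) - fderiv ℝ U y (rotGen y), U y⟫) := by
    refine integrable_gaussWeight_mul_of_norm_le (continuous_const.mul (hRc.inner hU.continuous))
      (C := 1 / 2 * (2 * C * C)) (N := (N + 1) + N) fun y => ?_
    rw [norm_mul, Real.norm_of_nonneg (by norm_num : (0 : ℝ) ≤ 1 / 2)]
    calc 1 / 2 * ‖⟪rotGen (U y) - fderiv ℝ U y (rotGen y), U y⟫‖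
        ≤ 1 / 2 * (‖rotGen (U y) - fderiv ℝ U y (rotGen y)‖ * ‖U y‖) :=
          mul_le_mul_of_nonneg_left (norm_inner_le_norm _ _) (by norm_num)
      _ ≤ 1 / 2 * ((2 * C * (1 + ‖y‖) ^ (N + 1)) * (C * (1 + ‖y‖) ^ N)) :=
          mul_le_mul_of_nonneg_left
            (mul_le_mul (hR0 y) (hU0 y) (norm_nonneg _) (by positivity)) (by norm_num)
      _ = 1 / 2 * (2 * C * C) * (1 + ‖y‖) ^ ((N + 1) + N) := by ring
  have hc2 : Continuous fun y => fderiv ℝ U y y :=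
    (hU.continuous_fderiv (by norm_num)).clm_apply continuous_id
  have hLc : Continuous fun y => -(Δ U) y + (1 / 2 : ℝ) • fderiv ℝ U y y :=
    (continuous_laplacian hU).neg.add (hc2.const_smul (1 / 2 : ℝ))
  have hL0 : ∀ y, ‖-(Δ U) y + (1 / 2 : ℝ) • fderiv ℝ U y y‖ ≤
      3 * C * (1 + ‖y‖) ^ N + C * (1 + ‖y‖) ^ (N + 1) := by
    intro y
    have hΔ : ‖(Δ U) y‖ ≤ 3 * C * (1 + ‖y‖) ^ N :=
      (norm_laplacian_le hU y).trans
        ((mul_le_mul_of_nonneg_left (hU2 y) (by norm_num)).trans_eq (mul_assoc _ _ _).symm)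
    have h3 : ‖fderiv ℝ U y y‖ ≤ C * (1 + ‖y‖) ^ (N + 1) := by
      calc ‖fderiv ℝ U y y‖ ≤ ‖fderiv ℝ U y‖ * ‖y‖ := ContinuousLinearMap.le_opNorm _ _
        _ ≤ C * (1 + ‖y‖) ^ N * (1 + ‖y‖) :=
            mul_le_mul (hU1 y) (by linarith [norm_nonneg y]) (norm_nonneg _) (hb0 y)
        _ = C * (1 + ‖y‖) ^ (N + 1) := by ring
    -- (no `calc`/`show` on `Δ`-terms: the `Laplacian` out-param delays elaboration and the
    -- goal unification then unfolds the `PiLp` norm)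
    have e1 := norm_add_le (-(Δ U) y) ((1 / 2 : ℝ) • fderiv ℝ U y y)
    rw [norm_neg, norm_smul, Real.norm_of_nonneg (by norm_num : (0 : ℝ) ≤ 1 / 2)] at e1
    linarith [norm_nonneg (fderiv ℝ U y y)]
  have i3 : Integrable fun y => gaussWeight y *
      ⟪rotGen (U y) - fderiv ℝ U y (rotGen y), -(Δ U) y + (1 / 2 : ℝ) • fderiv ℝ U y y⟫ := by
    refine integrable_gaussWeight_mul_of_norm_le (hRc.inner hLc)
      (C := 8 * C ^ 2) (N := (N + 1) + (N + 1)) fun y => ?_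
    have hone : (1 : ℝ) ≤ 1 + ‖y‖ := by linarith [norm_nonneg y]
    have h1 : C * (1 + ‖y‖) ^ N ≤ C * (1 + ‖y‖) ^ (N + 1) :=
      mul_le_mul_of_nonneg_left (pow_le_pow_right₀ hone (Nat.le_succ N)) hC
    have e3 := norm_inner_le_norm (𝕜 := ℝ) (rotGen (U y) - fderiv ℝ U y (rotGen y))
      (-(Δ U) y + (1 / 2 : ℝ) • fderiv ℝ U y y)
    have e4 : ‖rotGen (U y) - fderiv ℝ U y (rotGen y)‖ * ‖-(Δ U) y + (1 / 2 : ℝ) • fderiv ℝ U y y‖ ≤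
        (2 * C * (1 + ‖y‖) ^ (N + 1)) * (3 * C * (1 + ‖y‖) ^ (N + 1) + C * (1 + ‖y‖) ^ (N + 1)) :=
      mul_le_mul (hR0 y) ((hL0 y).trans (by linarith)) (norm_nonneg _) (by positivity)
    have e5 : (2 * C * (1 + ‖y‖) ^ (N + 1)) * (3 * C * (1 + ‖y‖) ^ (N + 1) + C * (1 + ‖y‖) ^ (N + 1)) =
        8 * C ^ 2 * (1 + ‖y‖) ^ ((N + 1) + (N + 1)) := by ring
    exact e3.trans (e4.trans_eq e5)
  have i12 : Integrable fun y => gaussWeight y * (α * ‖rotGen (U y) - fderiv ℝ U y (rotGen y)‖ ^ 2) +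
      gaussWeight y * ((1 / 2 : ℝ) * ⟪rotGen (U y) - fderiv ℝ U y (rotGen y), U y⟫) := i1.add i2
  rw [integral_add i12 i3, integral_add i1 i2]
  -- the two vanishing pairings
  have hI2 : ∫ y, gaussWeight y * ((1 / 2 : ℝ) * ⟪rotGen (U y) - fderiv ℝ U y (rotGen y), U y⟫) = 0 := by
    have e : (fun y => gaussWeight y * ((1 / 2 : ℝ) * ⟪rotGen (U y) - fderiv ℝ U y (rotGen y), U y⟫)) =
        fun y => (1 / 2 : ℝ) * (gaussWeight y * ⟪rotGen (U y) - fderiv ℝ U y (rotGen y), U y⟫) := by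
      funext y; ring
    rw [e, integral_const_mul,
      integral_gaussWeight_mul_inner_rotOp_self_eq_zero (hU.of_le one_le_two) hU0 hU1, mul_zero]
  have hI3 : ∫ y, gaussWeight y *
      ⟪rotGen (U y) - fderiv ℝ U y (rotGen y), -(Δ U) y + (1 / 2 : ℝ) • fderiv ℝ U y y⟫ = 0 := by
    have e : (fun y => gaussWeight y *
        ⟪rotGen (U y) - fderiv ℝ U y (rotGen y), -(Δ U) y + (1 / 2 : ℝ) • fderiv ℝ U y y⟫) = fun y =>
        gaussWeight y * ⟪-(Δ U) y + (1 / 2 : ℝ) • fderiv ℝ U y y,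
          rotGen (U y) - fderiv ℝ U y (rotGen y)⟫ := by
      funext y; rw [real_inner_comm]
    rw [e]; exact integral_gaussWeight_mul_inner_ou_rotOp_eq_zero hU hU0 hU1 hU2
  rw [hI2, hI3, add_zero, add_zero, ← integral_const_mul]
  exact integral_congr_ae (Filter.Eventually.of_forall fun y => by ring)

/-- **Pineau–Vicol 2026, (6.18) (p. 21), as printed: `|α| ‖𝓡U‖²_{L²_μ} = sgn(α) ⟨𝓡U, 𝓝⟩_{L²_μ}`**
for a `C²` solution of polynomial growth of the rotated profile system (6.16a) = (1.8), with
`𝓡U = JU − (Jy·∇)U` (6.1), `𝓝 = −(U·∇)U − ∇P` (6.10), `μ = e^{−|y|²/4}` (6.7) — "taking the `L²_μ`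
inner product of (6.16a) with `sgn(α) 𝓡U` … we obtain (6.18)". (The paper continues
`= sgn(α)⟨𝓡U, (𝓝)_a⟩ ≤ ‖𝓡U‖_{L²_μ} ‖(𝓝)_a‖_{L²_μ}`; the angular-mean projection `(·)_a` is not
formalised here.) [cite: PineauVicol2026, (6.18) (p. 21)] -/
theorem abs_mul_integral_gaussWeight_mul_norm_rotOp_sq
    {U : EuclideanSpace ℝ (Fin 3) → EuclideanSpace ℝ (Fin 3)} {P : EuclideanSpace ℝ (Fin 3) → ℝ} {α : ℝ}
    (hU : ContDiff ℝ 2 U) {C : ℝ} {N : ℕ} (hU0 : ∀ y, ‖U y‖ ≤ C * (1 + ‖y‖) ^ N)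
    (hU1 : ∀ y, ‖fderiv ℝ U y‖ ≤ C * (1 + ‖y‖) ^ N)
    (hU2 : ∀ y, ‖fderiv ℝ (fderiv ℝ U) y‖ ≤ C * (1 + ‖y‖) ^ N)
    (heq : ∀ y, α • (rotGen (U y) - fderiv ℝ U y (rotGen y)) + (1 / 2 : ℝ) • U y +
      (1 / 2 : ℝ) • fderiv ℝ U y y - (Δ U) y + convect U U y + gradient P y = 0) :
    |α| * ∫ y, gaussWeight y * ‖rotGen (U y) - fderiv ℝ U y (rotGen y)‖ ^ 2 =
      Real.sign α * ∫ y, gaussWeight y *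
        ⟪rotGen (U y) - fderiv ℝ U y (rotGen y), -(convect U U y) - gradient P y⟫ := by
  rw [← mul_integral_gaussWeight_mul_norm_rotOp_sq hU hU0 hU1 hU2 heq, ← mul_assoc]
  congr 1
  rcases lt_trichotomy α 0 with h | h | h
  · rw [Real.sign_of_neg h, abs_of_neg h]; ring
  · rw [h, Real.sign_zero, abs_zero]; ring
  · rw [Real.sign_of_pos h, abs_of_pos h]; ring


/-! ### The `L²_γ` energy identity of (6.16a) (p. 22, unprojected) -/

/-- Pointwise bound on the Ornstein–Uhlenbeck term `−ΔU + ½ DU[y]` from polynomial bounds on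
`DU`, `D²U`. [folklore] -/
private theorem norm_ouTerm_le {U : EuclideanSpace ℝ (Fin 3) → EuclideanSpace ℝ (Fin 3)}
    (hU : ContDiff ℝ 2 U) {C : ℝ} {N : ℕ} (hU1 : ∀ y, ‖fderiv ℝ U y‖ ≤ C * (1 + ‖y‖) ^ N)
    (hU2 : ∀ y, ‖fderiv ℝ (fderiv ℝ U) y‖ ≤ C * (1 + ‖y‖) ^ N) (hC : 0 ≤ C)
    (y : EuclideanSpace ℝ (Fin 3)) :
    ‖-(Δ U) y + (1 / 2 : ℝ) • fderiv ℝ U y y‖ ≤ 4 * C * (1 + ‖y‖) ^ (N + 1) := by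
  have hone : (1 : ℝ) ≤ 1 + ‖y‖ := by linarith [norm_nonneg y]
  have hb0 : 0 ≤ C * (1 + ‖y‖) ^ N := by positivity
  have h1 : C * (1 + ‖y‖) ^ N ≤ C * (1 + ‖y‖) ^ (N + 1) :=
    mul_le_mul_of_nonneg_left (pow_le_pow_right₀ hone (Nat.le_succ N)) hC
  have hΔ : ‖(Δ U) y‖ ≤ 3 * C * (1 + ‖y‖) ^ N :=
    (norm_laplacian_le hU y).trans
      ((mul_le_mul_of_nonneg_left (hU2 y) (by norm_num)).trans_eq (mul_assoc _ _ _).symm)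
  have h3 : ‖fderiv ℝ U y y‖ ≤ C * (1 + ‖y‖) ^ (N + 1) := by
    calc ‖fderiv ℝ U y y‖ ≤ ‖fderiv ℝ U y‖ * ‖y‖ := ContinuousLinearMap.le_opNorm _ _
      _ ≤ C * (1 + ‖y‖) ^ N * (1 + ‖y‖) :=
          mul_le_mul (hU1 y) (by linarith [norm_nonneg y]) (norm_nonneg _) hb0
      _ = C * (1 + ‖y‖) ^ (N + 1) := by ring
  -- (no `calc`/`show` on `Δ`-terms, see `mul_integral_gaussWeight_mul_norm_rotOp_sq`)
  have e1 := norm_add_le (-(Δ U) y) ((1 / 2 : ℝ) • fderiv ℝ U y y)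
  rw [norm_neg, norm_smul, Real.norm_of_nonneg (by norm_num : (0 : ℝ) ≤ 1 / 2)] at e1
  linarith [norm_nonneg (fderiv ℝ U y y)]

/-- **The `L²_μ` energy identity behind (6.19) (proof of Lemma 6.4, p. 22), unprojected form:
`½ ‖U‖²_{L²_μ} + ‖∇U‖²_{L²_μ} = ⟨𝓝, U⟩_{L²_μ}`** for a `C²` solution of polynomial growth of
(6.16a) = (1.8), `𝓝 = −(U·∇)U − ∇P`, `‖∇U‖² = Σᵢ |∂ᵢU|²`. The paper prints this computation for
the angular fluctuation `(U)_a` of `U` ("We take the `L²_μ` inner product of this identity with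
`(U)_a`, appeal to items (i) and (ii) in Lemma 6.2, and deduce
`½‖(U)_a‖²_{L²_μ} + ‖∇(U)_a‖²_{L²_μ} = ⟨(𝓝)_a, (U)_a⟩_{L²_μ}`"); pairing (6.16a) itself with `U`
is the same two steps: `α⟨𝓡U, U⟩_μ = 0` (item (ii)) and `⟨(−Δ + ½y·∇)U, U⟩_μ = ‖∇U‖²_μ`
(item (i)). The projection `(·)_a` is not formalised here.
[cite: PineauVicol2026, proof of Lemma 6.4 (p. 22)] -/
theorem half_mul_integral_gaussWeight_mul_norm_sq_add
    {U : EuclideanSpace ℝ (Fin 3) → EuclideanSpace ℝ (Fin 3)} {P : EuclideanSpace ℝ (Fin 3) → ℝ} {α : ℝ}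
    (hU : ContDiff ℝ 2 U) {C : ℝ} {N : ℕ} (hU0 : ∀ y, ‖U y‖ ≤ C * (1 + ‖y‖) ^ N)
    (hU1 : ∀ y, ‖fderiv ℝ U y‖ ≤ C * (1 + ‖y‖) ^ N)
    (hU2 : ∀ y, ‖fderiv ℝ (fderiv ℝ U) y‖ ≤ C * (1 + ‖y‖) ^ N)
    (heq : ∀ y, α • (rotGen (U y) - fderiv ℝ U y (rotGen y)) + (1 / 2 : ℝ) • U y +
      (1 / 2 : ℝ) • fderiv ℝ U y y - (Δ U) y + convect U U y + gradient P y = 0) :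
    (1 / 2 : ℝ) * (∫ y, gaussWeight y * ‖U y‖ ^ 2) +
        (∫ y, gaussWeight y * ∑ i, ‖fderiv ℝ U y (EuclideanSpace.basisFun (Fin 3) ℝ i)‖ ^ 2) =
      ∫ y, gaussWeight y * ⟪-(convect U U y) - gradient P y, U y⟫ := by
  have hC : 0 ≤ C := by
    have := (norm_nonneg (U 0)).trans (hU0 0)
    simpa using this
  -- from (6.16a): `𝓝 = α 𝓡U + ½ U + (−ΔU + ½ DU[y])`
  have hN : ∀ y, -(convect U U y) - gradient P y = α • (rotGen (U y) - fderiv ℝ U y (rotGen y)) +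
      (1 / 2 : ℝ) • U y + (-(Δ U) y + (1 / 2 : ℝ) • fderiv ℝ U y y) := fun y => by
    have h := heq y
    rw [eq_comm, ← sub_eq_zero, ← h]
    abel
  have e : (fun y => gaussWeight y * ⟪-(convect U U y) - gradient P y, U y⟫) = fun y =>
      α * (gaussWeight y * ⟪rotGen (U y) - fderiv ℝ U y (rotGen y), U y⟫) +
        (1 / 2 : ℝ) * (gaussWeight y * ‖U y‖ ^ 2) +
        gaussWeight y * ⟪-(Δ U) y + (1 / 2 : ℝ) • fderiv ℝ U y y, U y⟫ := by
    funext y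
    rw [hN y]
    simp only [inner_add_left, real_inner_smul_left, real_inner_self_eq_norm_sq]
    ring
  rw [e]
  -- integrability of the three pieces
  have hR0 : ∀ y, ‖rotGen (U y) - fderiv ℝ U y (rotGen y)‖ ≤ 2 * C * (1 + ‖y‖) ^ (N + 1) :=
    norm_rotOp_le hU0 hU1
  have hRc : Continuous fun y => rotGen (U y) - fderiv ℝ U y (rotGen y) :=
    ((contDiff_rotGen' (n := 1)).continuous.comp hU.continuous).sub
      ((hU.continuous_fderiv (by norm_num)).clm_apply (contDiff_rotGen' (n := 1)).continuous)
  have i1 : Integrable fun y =>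
      α * (gaussWeight y * ⟪rotGen (U y) - fderiv ℝ U y (rotGen y), U y⟫) := by
    refine Integrable.const_mul ?_ α
    refine integrable_gaussWeight_mul_of_norm_le (hRc.inner hU.continuous)
      (C := 2 * C * C) (N := (N + 1) + N) fun y => ?_
    calc ‖⟪rotGen (U y) - fderiv ℝ U y (rotGen y), U y⟫‖
        ≤ ‖rotGen (U y) - fderiv ℝ U y (rotGen y)‖ * ‖U y‖ := norm_inner_le_norm _ _
      _ ≤ (2 * C * (1 + ‖y‖) ^ (N + 1)) * (C * (1 + ‖y‖) ^ N) :=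
          mul_le_mul (hR0 y) (hU0 y) (norm_nonneg _) (by positivity)
      _ = 2 * C * C * (1 + ‖y‖) ^ ((N + 1) + N) := by ring
  have i2 : Integrable fun y => (1 / 2 : ℝ) * (gaussWeight y * ‖U y‖ ^ 2) := by
    refine Integrable.const_mul ?_ (1 / 2 : ℝ)
    refine integrable_gaussWeight_mul_of_norm_le (hU.continuous.norm.pow 2)
      (C := C ^ 2) (N := 2 * N) fun y => ?_
    rw [norm_pow, norm_norm]
    calc ‖U y‖ ^ 2 ≤ (C * (1 + ‖y‖) ^ N) ^ 2 := pow_le_pow_left₀ (norm_nonneg _) (hU0 y) 2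
      _ = C ^ 2 * (1 + ‖y‖) ^ (2 * N) := by ring
  have hc2 : Continuous fun y => fderiv ℝ U y y :=
    (hU.continuous_fderiv (by norm_num)).clm_apply continuous_id
  have hLc : Continuous fun y => -(Δ U) y + (1 / 2 : ℝ) • fderiv ℝ U y y :=
    (continuous_laplacian hU).neg.add (hc2.const_smul (1 / 2 : ℝ))
  have i3 : Integrable fun y =>
      gaussWeight y * ⟪-(Δ U) y + (1 / 2 : ℝ) • fderiv ℝ U y y, U y⟫ := by
    refine integrable_gaussWeight_mul_of_norm_le (hLc.inner hU.continuous)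
      (C := 4 * C * C) (N := (N + 1) + N) fun y => ?_
    have e3 := norm_inner_le_norm (𝕜 := ℝ) (-(Δ U) y + (1 / 2 : ℝ) • fderiv ℝ U y y) (U y)
    have e4 : ‖-(Δ U) y + (1 / 2 : ℝ) • fderiv ℝ U y y‖ * ‖U y‖ ≤
        (4 * C * (1 + ‖y‖) ^ (N + 1)) * (C * (1 + ‖y‖) ^ N) :=
      mul_le_mul (norm_ouTerm_le hU hU1 hU2 hC y) (hU0 y) (norm_nonneg _) (by positivity)
    have e5 : (4 * C * (1 + ‖y‖) ^ (N + 1)) * (C * (1 + ‖y‖) ^ N) =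
        4 * C * C * (1 + ‖y‖) ^ ((N + 1) + N) := by ring
    exact e3.trans (e4.trans_eq e5)
  have i12 : Integrable fun y => α * (gaussWeight y * ⟪rotGen (U y) - fderiv ℝ U y (rotGen y), U y⟫) +
      (1 / 2 : ℝ) * (gaussWeight y * ‖U y‖ ^ 2) := i1.add i2
  rw [integral_add i12 i3, integral_add i1 i2, integral_const_mul, integral_const_mul,
    integral_gaussWeight_mul_inner_rotOp_self_eq_zero (hU.of_le one_le_two) hU0 hU1, mul_zero, zero_add]
  -- the Ornstein–Uhlenbeck pairing is `‖∇U‖²_γ` (Lemma 6.2 (i))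
  rw [integral_gaussWeight_mul_inner_ou_self hU hU0 hU1 hU2]


/-! ### The two Gaussian integrations by parts of the Leray energy identity -/

/-- **`∫ γ ⟪(U·∇)U, U⟫ = ¼ ∫ γ (U·y) |U|²`** for a divergence-free `C¹` field of polynomial growth:
`⟪DU[U], U⟫ = ½ D|U|²[U]` and `∫ ⟪U, ∇(γ|U|²)⟫ = −∫ γ|U|² div U = 0` with `∇γ = −½ γ y`.
(The compact-support form is the tree's `integral_gaussian_inner_convect_self`; private: a standard
integration by parts, not a statement of the paper.) [folklore] -/
private theorem integral_gaussWeight_mul_inner_convect_self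
    {U : EuclideanSpace ℝ (Fin 3) → EuclideanSpace ℝ (Fin 3)} (hU : ContDiff ℝ 1 U)
    (hdiv : VectorCalculus.IsDivFree U) {C : ℝ} {N : ℕ} (hU0 : ∀ y, ‖U y‖ ≤ C * (1 + ‖y‖) ^ N)
    (hU1 : ∀ y, ‖fderiv ℝ U y‖ ≤ C * (1 + ‖y‖) ^ N) :
    ∫ y, gaussWeight y * ⟪convect U U y, U y⟫ =
      (1 / 4 : ℝ) * ∫ y, gaussWeight y * (⟪U y, y⟫ * ‖U y‖ ^ 2) := by
  have hC : 0 ≤ C := by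
    have := (norm_nonneg (U 0)).trans (hU0 0)
    simpa using this
  have hγ1 : ContDiff ℝ 1 (gaussWeight : EuclideanSpace ℝ (Fin 3) → ℝ) := contDiff_gaussWeight (n := 1)
  have hn : ContDiff ℝ 1 fun y => ‖U y‖ ^ 2 := hU.norm_sq ℝ
  have hθ : ContDiff ℝ 1 fun y => gaussWeight y * ‖U y‖ ^ 2 := hγ1.mul hn
  -- pointwise: `⟪U, ∇(γ|U|²)⟫ = −½ γ (U·y)|U|² + 2 γ ⟪DU[U], U⟫`
  have hpt : ∀ y, ⟪U y, gradient (fun z => gaussWeight z * ‖U z‖ ^ 2) y⟫ =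
      -(1 / 2 : ℝ) * (gaussWeight y * (⟪U y, y⟫ * ‖U y‖ ^ 2)) +
        2 * (gaussWeight y * ⟪convect U U y, U y⟫) := by
    intro y
    have hdγ : DifferentiableAt ℝ gaussWeight y := (hγ1.differentiable one_ne_zero) y
    have hdU : DifferentiableAt ℝ U y := (hU.differentiable one_ne_zero) y
    have hdn : DifferentiableAt ℝ (fun z => ‖U z‖ ^ 2) y := (hn.differentiable one_ne_zero) y
    rw [real_inner_comm, inner_gradient_left, fderiv_fun_mul hdγ hdn, hdU.hasFDerivAt.norm_sq.fderiv]
    simp only [add_apply, smul_apply, smul_eq_mul, fderiv_gaussWeight_apply,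
      ContinuousLinearMap.comp_apply, innerSL_apply_apply, convect_apply, real_inner_comm (U y) y,
      real_inner_comm (U y) (fderiv ℝ U y (U y))]
    ring
  -- integrability
  have hint : Integrable fun y => (gaussWeight y * ‖U y‖ ^ 2) • U y := by
    have e : (fun y => (gaussWeight y * ‖U y‖ ^ 2) • U y) =
        fun y => gaussWeight y • (‖U y‖ ^ 2 • U y) := by
      funext y; rw [mul_smul]
    rw [e]
    refine integrable_gaussWeight_smul_of_norm_le ((hU.continuous.norm.pow 2).smul hU.continuous)
      (C := C ^ 2 * C) (N := 2 * N + N) fun y => ?_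
    rw [norm_smul, norm_pow, norm_norm]
    calc ‖U y‖ ^ 2 * ‖U y‖ ≤ (C * (1 + ‖y‖) ^ N) ^ 2 * (C * (1 + ‖y‖) ^ N) :=
          mul_le_mul (pow_le_pow_left₀ (norm_nonneg _) (hU0 y) 2) (hU0 y) (norm_nonneg _)
            (by positivity)
      _ = C ^ 2 * C * (1 + ‖y‖) ^ (2 * N + N) := by ring
  have hcv : Continuous fun y => convect U U y :=
    (hU.continuous_fderiv one_ne_zero).clm_apply hU.continuous
  have iA : Integrable fun y => gaussWeight y * (⟪U y, y⟫ * ‖U y‖ ^ 2) := by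
    refine integrable_gaussWeight_mul_of_norm_le
      ((hU.continuous.inner continuous_id).mul (hU.continuous.norm.pow 2))
      (C := C * C ^ 2) (N := (N + 1) + 2 * N) fun y => ?_
    rw [norm_mul, norm_pow, norm_norm]
    calc ‖⟪U y, y⟫‖ * ‖U y‖ ^ 2 ≤ (C * (1 + ‖y‖) ^ (N + 1)) * (C * (1 + ‖y‖) ^ N) ^ 2 := by
          refine mul_le_mul ?_ (pow_le_pow_left₀ (norm_nonneg _) (hU0 y) 2) (by positivity)
            (by positivity)
          calc ‖⟪U y, y⟫‖ ≤ ‖U y‖ * ‖y‖ := norm_inner_le_norm _ _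
            _ ≤ C * (1 + ‖y‖) ^ N * (1 + ‖y‖) :=
                mul_le_mul (hU0 y) (by linarith [norm_nonneg y]) (norm_nonneg _) (by positivity)
            _ = C * (1 + ‖y‖) ^ (N + 1) := by ring
      _ = C * C ^ 2 * (1 + ‖y‖) ^ ((N + 1) + 2 * N) := by ring
  have iB : Integrable fun y => gaussWeight y * ⟪convect U U y, U y⟫ := by
    refine integrable_gaussWeight_mul_of_norm_le (hcv.inner hU.continuous)
      (C := C * C * C) (N := (N + N) + N) fun y => ?_
    calc ‖⟪convect U U y, U y⟫‖ ≤ ‖convect U U y‖ * ‖U y‖ := norm_inner_le_norm _ _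
      _ ≤ (C * (1 + ‖y‖) ^ N * (C * (1 + ‖y‖) ^ N)) * (C * (1 + ‖y‖) ^ N) := by
          refine mul_le_mul ?_ (hU0 y) (norm_nonneg _) (by positivity)
          rw [convect_apply]
          exact (ContinuousLinearMap.le_opNorm _ _).trans
            (mul_le_mul (hU1 y) (hU0 y) (norm_nonneg _) (by positivity))
      _ = C * C * C * (1 + ‖y‖) ^ ((N + N) + N) := by ring
  have h2 : Integrable fun y => ⟪U y, gradient (fun z => gaussWeight z * ‖U z‖ ^ 2) y⟫ := by
    simp_rw [hpt]
    have iA' : Integrable fun y => -(1 / 2 : ℝ) * (gaussWeight y * (⟪U y, y⟫ * ‖U y‖ ^ 2)) :=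
      iA.const_mul _
    have iB' : Integrable fun y => 2 * (gaussWeight y * ⟪convect U U y, U y⟫) := iB.const_mul _
    exact iA'.add iB'
  have key := integral_mul_divergence_add_eq_zero_of_integrable hθ hU hint
    (by simp only [hdiv _, mul_zero]; exact integrable_zero _ _ _) h2
  simp only [hdiv _, mul_zero, integral_zero, zero_add] at key
  simp_rw [hpt] at key
  have iA' : Integrable fun y => -(1 / 2 : ℝ) * (gaussWeight y * (⟪U y, y⟫ * ‖U y‖ ^ 2)) :=
    iA.const_mul _
  have iB' : Integrable fun y => 2 * (gaussWeight y * ⟪convect U U y, U y⟫) := iB.const_mul _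
  rw [integral_add iA' iB', integral_const_mul, integral_const_mul] at key
  linarith

/-- **`∫ γ ⟪∇P, U⟫ = ½ ∫ γ P (U·y)`** for a divergence-free `C¹` field `U` and a `C¹` scalar `P`,
both of polynomial growth: `∫ ⟪U, ∇(γP)⟫ = −∫ γ P div U = 0` with `∇γ = −½ γ y` (private: a
standard integration by parts, not a statement of the paper). [folklore] -/
private theorem integral_gaussWeight_mul_inner_gradient
    {U : EuclideanSpace ℝ (Fin 3) → EuclideanSpace ℝ (Fin 3)} {P : EuclideanSpace ℝ (Fin 3) → ℝ}
    (hU : ContDiff ℝ 1 U) (hdiv : VectorCalculus.IsDivFree U) (hP : ContDiff ℝ 1 P)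
    {C : ℝ} {N : ℕ} (hU0 : ∀ y, ‖U y‖ ≤ C * (1 + ‖y‖) ^ N) (hP0 : ∀ y, ‖P y‖ ≤ C * (1 + ‖y‖) ^ N)
    (hP1 : ∀ y, ‖fderiv ℝ P y‖ ≤ C * (1 + ‖y‖) ^ N) :
    ∫ y, gaussWeight y * ⟪gradient P y, U y⟫ =
      (1 / 2 : ℝ) * ∫ y, gaussWeight y * (P y * ⟪U y, y⟫) := by
  have hC : 0 ≤ C := by
    have := (norm_nonneg (U 0)).trans (hU0 0)
    simpa using this
  have hγ1 : ContDiff ℝ 1 (gaussWeight : EuclideanSpace ℝ (Fin 3) → ℝ) := contDiff_gaussWeight (n := 1)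
  have hθ : ContDiff ℝ 1 fun y => gaussWeight y * P y := hγ1.mul hP
  -- pointwise: `⟪U, ∇(γP)⟫ = −½ γ P (U·y) + γ ⟪∇P, U⟫`
  have hpt : ∀ y, ⟪U y, gradient (fun z => gaussWeight z * P z) y⟫ =
      -(1 / 2 : ℝ) * (gaussWeight y * (P y * ⟪U y, y⟫)) + gaussWeight y * ⟪gradient P y, U y⟫ := by
    intro y
    have hdγ : DifferentiableAt ℝ gaussWeight y := (hγ1.differentiable one_ne_zero) y
    have hdP : DifferentiableAt ℝ P y := (hP.differentiable one_ne_zero) y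
    rw [real_inner_comm, inner_gradient_left, fderiv_fun_mul hdγ hdP, inner_gradient_left]
    simp only [add_apply, smul_apply, smul_eq_mul, fderiv_gaussWeight_apply, real_inner_comm (U y) y]
    ring
  -- integrability
  have hint : Integrable fun y => (gaussWeight y * P y) • U y := by
    have e : (fun y => (gaussWeight y * P y) • U y) = fun y => gaussWeight y • (P y • U y) := by
      funext y; rw [mul_smul]
    rw [e]
    refine integrable_gaussWeight_smul_of_norm_le (hP.continuous.smul hU.continuous)
      (C := C * C) (N := N + N) fun y => ?_
    rw [norm_smul]
    calc ‖P y‖ * ‖U y‖ ≤ (C * (1 + ‖y‖) ^ N) * (C * (1 + ‖y‖) ^ N) :=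
          mul_le_mul (hP0 y) (hU0 y) (norm_nonneg _) (by positivity)
      _ = C * C * (1 + ‖y‖) ^ (N + N) := by ring
  have iA : Integrable fun y => gaussWeight y * (P y * ⟪U y, y⟫) := by
    refine integrable_gaussWeight_mul_of_norm_le
      (hP.continuous.mul (hU.continuous.inner continuous_id))
      (C := C * C) (N := N + (N + 1)) fun y => ?_
    rw [norm_mul]
    calc ‖P y‖ * ‖⟪U y, y⟫‖ ≤ (C * (1 + ‖y‖) ^ N) * (C * (1 + ‖y‖) ^ (N + 1)) := by
          refine mul_le_mul (hP0 y) ?_ (norm_nonneg _) (by positivity)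
          calc ‖⟪U y, y⟫‖ ≤ ‖U y‖ * ‖y‖ := norm_inner_le_norm _ _
            _ ≤ C * (1 + ‖y‖) ^ N * (1 + ‖y‖) :=
                mul_le_mul (hU0 y) (by linarith [norm_nonneg y]) (norm_nonneg _) (by positivity)
            _ = C * (1 + ‖y‖) ^ (N + 1) := by ring
      _ = C * C * (1 + ‖y‖) ^ (N + (N + 1)) := by ring
  have iB : Integrable fun y => gaussWeight y * ⟪gradient P y, U y⟫ := by
    refine integrable_gaussWeight_mul_of_norm_le
      ((continuous_gradient_of_contDiff hP).inner hU.continuous)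
      (C := C * C) (N := N + N) fun y => ?_
    calc ‖⟪gradient P y, U y⟫‖ ≤ ‖gradient P y‖ * ‖U y‖ := norm_inner_le_norm _ _
      _ ≤ (C * (1 + ‖y‖) ^ N) * (C * (1 + ‖y‖) ^ N) := by
          refine mul_le_mul ?_ (hU0 y) (norm_nonneg _) (by positivity)
          rw [norm_gradient_eq_norm_fderiv]; exact hP1 y
      _ = C * C * (1 + ‖y‖) ^ (N + N) := by ring
  have iA' : Integrable fun y => -(1 / 2 : ℝ) * (gaussWeight y * (P y * ⟪U y, y⟫)) := iA.const_mul _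
  have h2 : Integrable fun y => ⟪U y, gradient (fun z => gaussWeight z * P z) y⟫ := by
    simp_rw [hpt]; exact iA'.add iB
  have key := integral_mul_divergence_add_eq_zero_of_integrable hθ hU hint
    (by simp only [hdiv _, mul_zero]; exact integrable_zero _ _ _) h2
  simp only [hdiv _, mul_zero, integral_zero, zero_add] at key
  simp_rw [hpt] at key
  rw [integral_add iA' iB, integral_const_mul] at key
  linarith

/-- **The Gaussian (Leray) energy identity of a steady rotated profile:
`½ ‖U‖²_{L²_γ} + ‖∇U‖²_{L²_γ} = −½ ∫ γ (½|U|² + P)(U·y) dy`** — the `L²_γ` pairing of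
(6.16a) = (1.8) with `U` (`½‖U‖²_γ + ‖∇U‖²_γ = ⟨𝓝, U⟩_γ`, the unprojected form of the identity
printed before (6.19), p. 22) followed by the two integrations by parts
`⟨(U·∇)U, U⟩_γ = ¼∫γ(U·y)|U|²`, `⟨∇P, U⟩_γ = ½∫γP(U·y)` (`∇·U = 0`, `∇γ = −½γy`): the source of
the weighted energy balance is the Bernoulli head `½|U|² + P` against the radial flux `U·y`.
For `U ∈ C²`, `P ∈ C¹`, `∇·U = 0`, polynomial growth of `U, DU, D²U, P, DP`. (Not displayed in
the paper, which projects onto the angular fluctuation first; recorded here as the unprojected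
companion.) [cite: PineauVicol2026, proof of Lemma 6.4 (p. 22)] -/
theorem half_mul_integral_gaussWeight_mul_norm_sq_add_eq_head_flux
    {U : EuclideanSpace ℝ (Fin 3) → EuclideanSpace ℝ (Fin 3)} {P : EuclideanSpace ℝ (Fin 3) → ℝ} {α : ℝ}
    (hU : ContDiff ℝ 2 U) (hP : ContDiff ℝ 1 P) (hdiv : VectorCalculus.IsDivFree U) {C : ℝ} {N : ℕ}
    (hU0 : ∀ y, ‖U y‖ ≤ C * (1 + ‖y‖) ^ N) (hU1 : ∀ y, ‖fderiv ℝ U y‖ ≤ C * (1 + ‖y‖) ^ N)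
    (hU2 : ∀ y, ‖fderiv ℝ (fderiv ℝ U) y‖ ≤ C * (1 + ‖y‖) ^ N)
    (hP0 : ∀ y, ‖P y‖ ≤ C * (1 + ‖y‖) ^ N) (hP1 : ∀ y, ‖fderiv ℝ P y‖ ≤ C * (1 + ‖y‖) ^ N)
    (heq : ∀ y, α • (rotGen (U y) - fderiv ℝ U y (rotGen y)) + (1 / 2 : ℝ) • U y +
      (1 / 2 : ℝ) • fderiv ℝ U y y - (Δ U) y + convect U U y + gradient P y = 0) :
    (1 / 2 : ℝ) * (∫ y, gaussWeight y * ‖U y‖ ^ 2) +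
        (∫ y, gaussWeight y * ∑ i, ‖fderiv ℝ U y (EuclideanSpace.basisFun (Fin 3) ℝ i)‖ ^ 2) =
      -(1 / 2 : ℝ) * ∫ y, gaussWeight y * (((1 / 2 : ℝ) * ‖U y‖ ^ 2 + P y) * ⟪U y, y⟫) := by
  have hU' : ContDiff ℝ 1 U := hU.of_le one_le_two
  rw [half_mul_integral_gaussWeight_mul_norm_sq_add hU hU0 hU1 hU2 heq]
  have hA := integral_gaussWeight_mul_inner_convect_self hU' hdiv hU0 hU1
  have hB := integral_gaussWeight_mul_inner_gradient hU' hdiv hP hU0 hP0 hP1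
  -- integrability of the two pairings (polynomial growth)
  have hC : 0 ≤ C := by
    have := (norm_nonneg (U 0)).trans (hU0 0)
    simpa using this
  have hcv : Continuous fun y => convect U U y :=
    (hU'.continuous_fderiv one_ne_zero).clm_apply hU.continuous
  have i1 : Integrable fun y => gaussWeight y * ⟪convect U U y, U y⟫ := by
    refine integrable_gaussWeight_mul_of_norm_le (hcv.inner hU.continuous)
      (C := C * C * C) (N := (N + N) + N) fun y => ?_
    calc ‖⟪convect U U y, U y⟫‖ ≤ ‖convect U U y‖ * ‖U y‖ := norm_inner_le_norm _ _
      _ ≤ (C * (1 + ‖y‖) ^ N * (C * (1 + ‖y‖) ^ N)) * (C * (1 + ‖y‖) ^ N) := by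
          refine mul_le_mul ?_ (hU0 y) (norm_nonneg _) (by positivity)
          rw [convect_apply]
          exact (ContinuousLinearMap.le_opNorm _ _).trans
            (mul_le_mul (hU1 y) (hU0 y) (norm_nonneg _) (by positivity))
      _ = C * C * C * (1 + ‖y‖) ^ ((N + N) + N) := by ring
  have i2 : Integrable fun y => gaussWeight y * ⟪gradient P y, U y⟫ := by
    refine integrable_gaussWeight_mul_of_norm_le
      ((continuous_gradient_of_contDiff hP).inner hU.continuous)
      (C := C * C) (N := N + N) fun y => ?_
    calc ‖⟪gradient P y, U y⟫‖ ≤ ‖gradient P y‖ * ‖U y‖ := norm_inner_le_norm _ _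
      _ ≤ (C * (1 + ‖y‖) ^ N) * (C * (1 + ‖y‖) ^ N) := by
          refine mul_le_mul ?_ (hU0 y) (norm_nonneg _) (by positivity)
          rw [norm_gradient_eq_norm_fderiv]; exact hP1 y
      _ = C * C * (1 + ‖y‖) ^ (N + N) := by ring
  have iS : Integrable fun y => gaussWeight y * (⟪U y, y⟫ * ‖U y‖ ^ 2) := by
    refine integrable_gaussWeight_mul_of_norm_le
      ((hU.continuous.inner continuous_id).mul (hU.continuous.norm.pow 2))
      (C := C * C ^ 2) (N := (N + 1) + 2 * N) fun y => ?_
    rw [norm_mul, norm_pow, norm_norm]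
    calc ‖⟪U y, y⟫‖ * ‖U y‖ ^ 2 ≤ (C * (1 + ‖y‖) ^ (N + 1)) * (C * (1 + ‖y‖) ^ N) ^ 2 := by
          refine mul_le_mul ?_ (pow_le_pow_left₀ (norm_nonneg _) (hU0 y) 2) (by positivity)
            (by positivity)
          calc ‖⟪U y, y⟫‖ ≤ ‖U y‖ * ‖y‖ := norm_inner_le_norm _ _
            _ ≤ C * (1 + ‖y‖) ^ N * (1 + ‖y‖) :=
                mul_le_mul (hU0 y) (by linarith [norm_nonneg y]) (norm_nonneg _) (by positivity)
            _ = C * (1 + ‖y‖) ^ (N + 1) := by ring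
      _ = C * C ^ 2 * (1 + ‖y‖) ^ ((N + 1) + 2 * N) := by ring
  have iT : Integrable fun y => gaussWeight y * (P y * ⟪U y, y⟫) := by
    refine integrable_gaussWeight_mul_of_norm_le
      (hP.continuous.mul (hU.continuous.inner continuous_id))
      (C := C * C) (N := N + (N + 1)) fun y => ?_
    rw [norm_mul]
    calc ‖P y‖ * ‖⟪U y, y⟫‖ ≤ (C * (1 + ‖y‖) ^ N) * (C * (1 + ‖y‖) ^ (N + 1)) := by
          refine mul_le_mul (hP0 y) ?_ (norm_nonneg _) (by positivity)
          calc ‖⟪U y, y⟫‖ ≤ ‖U y‖ * ‖y‖ := norm_inner_le_norm _ _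
            _ ≤ C * (1 + ‖y‖) ^ N * (1 + ‖y‖) :=
                mul_le_mul (hU0 y) (by linarith [norm_nonneg y]) (norm_nonneg _) (by positivity)
            _ = C * (1 + ‖y‖) ^ (N + 1) := by ring
      _ = C * C * (1 + ‖y‖) ^ (N + (N + 1)) := by ring
  -- split `⟨𝓝, U⟩_γ = −⟨(U·∇)U, U⟩_γ − ⟨∇P, U⟩_γ` and the right-hand side
  have e1 : (fun y => gaussWeight y * ⟪-(convect U U y) - gradient P y, U y⟫) = fun y =>
      -(gaussWeight y * ⟪convect U U y, U y⟫) - gaussWeight y * ⟪gradient P y, U y⟫ := by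
    funext y; rw [inner_sub_left, inner_neg_left]; ring
  have e2 : (fun y => gaussWeight y * (((1 / 2 : ℝ) * ‖U y‖ ^ 2 + P y) * ⟪U y, y⟫)) = fun y =>
      (1 / 2 : ℝ) * (gaussWeight y * (⟪U y, y⟫ * ‖U y‖ ^ 2)) + gaussWeight y * (P y * ⟪U y, y⟫) := by
    funext y; ring
  have i1n : Integrable fun y => -(gaussWeight y * ⟪convect U U y, U y⟫) := i1.neg
  have iSh : Integrable fun y => (1 / 2 : ℝ) * (gaussWeight y * (⟪U y, y⟫ * ‖U y‖ ^ 2)) :=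
    iS.const_mul _
  rw [e1, e2, integral_sub i1n i2, integral_neg, integral_add iSh iT, integral_const_mul, hA, hB]
  ring


/-! ### The slice form: the `∂_s U` pairing of the time-dependent profile equation -/

/-- **The `L²_γ` energy balance of a slice of the (rotated) Leray similarity flow.** If
`U_s + α𝓡U + ½U + ½DU[y] − ΔU + (U·∇)U + ∇P = 0` pointwise (the profile equation (6.16a) = (1.8)
with the time derivative `∂_sU =: U_s` of the self-similar/RDSS ansatz retained, as in (7.7),
p. 25: "`LΠ + |Ω|² = αE − (U + y/2)·∂_sU`", here on the velocity side), `∇·U = 0`, `U ∈ C²`,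
`P ∈ C¹`, polynomial growth of `U, DU, D²U, P, DP`, then
`⟨U_s, U⟩_γ = −½‖U‖²_γ − ‖∇U‖²_γ − ½ ∫ γ (½|U|² + P)(U·y)`,
i.e. `d/ds ½‖U‖²_γ = −‖∇U‖²_γ − ½‖U‖²_γ − ½∫γ(½|U|² + P)(U·y)` once `⟨∂_sU, U⟩_γ = d/ds ½‖U‖²_γ`:
the pairing with `U` (Lemma 6.2 (i), (ii): `⟨𝓡U, U⟩_γ = 0`, `⟨(−Δ+½y·∇)U, U⟩_γ = ‖∇U‖²_γ`, as on
p. 22) followed by the two Gaussian integrations by parts of `⟨𝓝, U⟩_γ`. The steady case `U_s = 0`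
is `half_mul_integral_gaussWeight_mul_norm_sq_add_eq_head_flux`. (The `s`-bookkeeping
`⟨∂_sU, U⟩_γ = d/ds ½‖U‖²_γ` is not part of this statement.)
[cite: PineauVicol2026, Lemma 6.2 (i)–(ii) (p. 19), proof of Lemma 6.4 (pp. 21–22), (7.7) (p. 25)] -/
theorem integral_gaussWeight_mul_inner_sliceDeriv_eq
    {U Us : EuclideanSpace ℝ (Fin 3) → EuclideanSpace ℝ (Fin 3)} {P : EuclideanSpace ℝ (Fin 3) → ℝ}
    {α : ℝ} (hU : ContDiff ℝ 2 U) (hP : ContDiff ℝ 1 P) (hdiv : VectorCalculus.IsDivFree U)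
    {C : ℝ} {N : ℕ} (hU0 : ∀ y, ‖U y‖ ≤ C * (1 + ‖y‖) ^ N)
    (hU1 : ∀ y, ‖fderiv ℝ U y‖ ≤ C * (1 + ‖y‖) ^ N)
    (hU2 : ∀ y, ‖fderiv ℝ (fderiv ℝ U) y‖ ≤ C * (1 + ‖y‖) ^ N)
    (hP0 : ∀ y, ‖P y‖ ≤ C * (1 + ‖y‖) ^ N) (hP1 : ∀ y, ‖fderiv ℝ P y‖ ≤ C * (1 + ‖y‖) ^ N)
    (heq : ∀ y, Us y + α • (rotGen (U y) - fderiv ℝ U y (rotGen y)) + (1 / 2 : ℝ) • U y +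
      (1 / 2 : ℝ) • fderiv ℝ U y y - (Δ U) y + convect U U y + gradient P y = 0) :
    ∫ y, gaussWeight y * ⟪Us y, U y⟫ =
      -((1 / 2 : ℝ) * ∫ y, gaussWeight y * ‖U y‖ ^ 2) -
        (∫ y, gaussWeight y * ∑ i, ‖fderiv ℝ U y (EuclideanSpace.basisFun (Fin 3) ℝ i)‖ ^ 2) -
        (1 / 2 : ℝ) * ∫ y, gaussWeight y * (((1 / 2 : ℝ) * ‖U y‖ ^ 2 + P y) * ⟪U y, y⟫) := by
  have hC : 0 ≤ C := by
    have := (norm_nonneg (U 0)).trans (hU0 0)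
    simpa using this
  have hU' : ContDiff ℝ 1 U := hU.of_le one_le_two
  -- from the equation: `U_s = 𝓝 − α𝓡U − ½U − (−ΔU + ½DU[y])`, `𝓝 = −(U·∇)U − ∇P`
  have hS : ∀ y, Us y = (-(convect U U y) - gradient P y) -
      α • (rotGen (U y) - fderiv ℝ U y (rotGen y)) - (1 / 2 : ℝ) • U y -
      (-(Δ U) y + (1 / 2 : ℝ) • fderiv ℝ U y y) := fun y => by
    have h := heq y
    rw [← sub_eq_zero, ← h]
    abel
  have e : (fun y => gaussWeight y * ⟪Us y, U y⟫) = fun y =>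
      (-(gaussWeight y * ⟪convect U U y, U y⟫) - gaussWeight y * ⟪gradient P y, U y⟫) -
        α * (gaussWeight y * ⟪rotGen (U y) - fderiv ℝ U y (rotGen y), U y⟫) -
        (1 / 2 : ℝ) * (gaussWeight y * ‖U y‖ ^ 2) -
        gaussWeight y * ⟪-(Δ U) y + (1 / 2 : ℝ) • fderiv ℝ U y y, U y⟫ := by
    funext y
    rw [hS y]
    simp only [inner_sub_left, inner_neg_left, real_inner_smul_left, real_inner_self_eq_norm_sq]
    ring
  rw [e]
  -- integrability of the five pieces (polynomial growth against `γ`)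
  have hcv : Continuous fun y => convect U U y :=
    (hU'.continuous_fderiv one_ne_zero).clm_apply hU.continuous
  have i1 : Integrable fun y => gaussWeight y * ⟪convect U U y, U y⟫ := by
    refine integrable_gaussWeight_mul_of_norm_le (hcv.inner hU.continuous)
      (C := C * C * C) (N := (N + N) + N) fun y => ?_
    calc ‖⟪convect U U y, U y⟫‖ ≤ ‖convect U U y‖ * ‖U y‖ := norm_inner_le_norm _ _
      _ ≤ (C * (1 + ‖y‖) ^ N * (C * (1 + ‖y‖) ^ N)) * (C * (1 + ‖y‖) ^ N) := by
          refine mul_le_mul ?_ (hU0 y) (norm_nonneg _) (by positivity)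
          rw [convect_apply]
          exact (ContinuousLinearMap.le_opNorm _ _).trans
            (mul_le_mul (hU1 y) (hU0 y) (norm_nonneg _) (by positivity))
      _ = C * C * C * (1 + ‖y‖) ^ ((N + N) + N) := by ring
  have i2 : Integrable fun y => gaussWeight y * ⟪gradient P y, U y⟫ := by
    refine integrable_gaussWeight_mul_of_norm_le
      ((continuous_gradient_of_contDiff hP).inner hU.continuous)
      (C := C * C) (N := N + N) fun y => ?_
    calc ‖⟪gradient P y, U y⟫‖ ≤ ‖gradient P y‖ * ‖U y‖ := norm_inner_le_norm _ _
      _ ≤ (C * (1 + ‖y‖) ^ N) * (C * (1 + ‖y‖) ^ N) := by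
          refine mul_le_mul ?_ (hU0 y) (norm_nonneg _) (by positivity)
          rw [norm_gradient_eq_norm_fderiv]; exact hP1 y
      _ = C * C * (1 + ‖y‖) ^ (N + N) := by ring
  have hR0 : ∀ y, ‖rotGen (U y) - fderiv ℝ U y (rotGen y)‖ ≤ 2 * C * (1 + ‖y‖) ^ (N + 1) :=
    norm_rotOp_le hU0 hU1
  have hRc : Continuous fun y => rotGen (U y) - fderiv ℝ U y (rotGen y) :=
    ((contDiff_rotGen' (n := 1)).continuous.comp hU.continuous).sub
      ((hU.continuous_fderiv (by norm_num)).clm_apply (contDiff_rotGen' (n := 1)).continuous)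
  have i3 : Integrable fun y =>
      α * (gaussWeight y * ⟪rotGen (U y) - fderiv ℝ U y (rotGen y), U y⟫) := by
    refine Integrable.const_mul ?_ α
    refine integrable_gaussWeight_mul_of_norm_le (hRc.inner hU.continuous)
      (C := 2 * C * C) (N := (N + 1) + N) fun y => ?_
    calc ‖⟪rotGen (U y) - fderiv ℝ U y (rotGen y), U y⟫‖
        ≤ ‖rotGen (U y) - fderiv ℝ U y (rotGen y)‖ * ‖U y‖ := norm_inner_le_norm _ _
      _ ≤ (2 * C * (1 + ‖y‖) ^ (N + 1)) * (C * (1 + ‖y‖) ^ N) :=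
          mul_le_mul (hR0 y) (hU0 y) (norm_nonneg _) (by positivity)
      _ = 2 * C * C * (1 + ‖y‖) ^ ((N + 1) + N) := by ring
  have i4 : Integrable fun y => (1 / 2 : ℝ) * (gaussWeight y * ‖U y‖ ^ 2) := by
    refine Integrable.const_mul ?_ (1 / 2 : ℝ)
    refine integrable_gaussWeight_mul_of_norm_le (hU.continuous.norm.pow 2)
      (C := C ^ 2) (N := 2 * N) fun y => ?_
    rw [norm_pow, norm_norm]
    calc ‖U y‖ ^ 2 ≤ (C * (1 + ‖y‖) ^ N) ^ 2 := pow_le_pow_left₀ (norm_nonneg _) (hU0 y) 2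
      _ = C ^ 2 * (1 + ‖y‖) ^ (2 * N) := by ring
  have hc2 : Continuous fun y => fderiv ℝ U y y :=
    (hU.continuous_fderiv (by norm_num)).clm_apply continuous_id
  have hLc : Continuous fun y => -(Δ U) y + (1 / 2 : ℝ) • fderiv ℝ U y y :=
    (continuous_laplacian hU).neg.add (hc2.const_smul (1 / 2 : ℝ))
  have i5 : Integrable fun y =>
      gaussWeight y * ⟪-(Δ U) y + (1 / 2 : ℝ) • fderiv ℝ U y y, U y⟫ := by
    refine integrable_gaussWeight_mul_of_norm_le (hLc.inner hU.continuous)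
      (C := 4 * C * C) (N := (N + 1) + N) fun y => ?_
    have e3 := norm_inner_le_norm (𝕜 := ℝ) (-(Δ U) y + (1 / 2 : ℝ) • fderiv ℝ U y y) (U y)
    have e4 : ‖-(Δ U) y + (1 / 2 : ℝ) • fderiv ℝ U y y‖ * ‖U y‖ ≤
        (4 * C * (1 + ‖y‖) ^ (N + 1)) * (C * (1 + ‖y‖) ^ N) :=
      mul_le_mul (norm_ouTerm_le hU hU1 hU2 hC y) (hU0 y) (norm_nonneg _) (by positivity)
    have e5 : (4 * C * (1 + ‖y‖) ^ (N + 1)) * (C * (1 + ‖y‖) ^ N) =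
        4 * C * C * (1 + ‖y‖) ^ ((N + 1) + N) := by ring
    exact e3.trans (e4.trans_eq e5)
  have i1n : Integrable fun y => -(gaussWeight y * ⟪convect U U y, U y⟫) := i1.neg
  have i12 : Integrable fun y =>
      -(gaussWeight y * ⟪convect U U y, U y⟫) - gaussWeight y * ⟪gradient P y, U y⟫ := i1n.sub i2
  have i123 : Integrable fun y =>
      (-(gaussWeight y * ⟪convect U U y, U y⟫) - gaussWeight y * ⟪gradient P y, U y⟫) -
        α * (gaussWeight y * ⟪rotGen (U y) - fderiv ℝ U y (rotGen y), U y⟫) := i12.sub i3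
  have i1234 : Integrable fun y =>
      (-(gaussWeight y * ⟪convect U U y, U y⟫) - gaussWeight y * ⟪gradient P y, U y⟫) -
        α * (gaussWeight y * ⟪rotGen (U y) - fderiv ℝ U y (rotGen y), U y⟫) -
        (1 / 2 : ℝ) * (gaussWeight y * ‖U y‖ ^ 2) := i123.sub i4
  rw [integral_sub i1234 i5, integral_sub i123 i4, integral_sub i12 i3, integral_sub i1n i2,
    integral_neg, integral_const_mul, integral_const_mul,
    integral_gaussWeight_mul_inner_rotOp_self_eq_zero hU' hU0 hU1, mul_zero, sub_zero,
    integral_gaussWeight_mul_inner_convect_self hU' hdiv hU0 hU1,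
    integral_gaussWeight_mul_inner_gradient hU' hdiv hP hU0 hP0 hP1,
    integral_gaussWeight_mul_inner_ou_self hU hU0 hU1 hU2]
  -- the right-hand side: split the head flux
  have iS : Integrable fun y => gaussWeight y * (⟪U y, y⟫ * ‖U y‖ ^ 2) := by
    refine integrable_gaussWeight_mul_of_norm_le
      ((hU.continuous.inner continuous_id).mul (hU.continuous.norm.pow 2))
      (C := C * C ^ 2) (N := (N + 1) + 2 * N) fun y => ?_
    rw [norm_mul, norm_pow, norm_norm]
    calc ‖⟪U y, y⟫‖ * ‖U y‖ ^ 2 ≤ (C * (1 + ‖y‖) ^ (N + 1)) * (C * (1 + ‖y‖) ^ N) ^ 2 := by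
          refine mul_le_mul ?_ (pow_le_pow_left₀ (norm_nonneg _) (hU0 y) 2) (by positivity)
            (by positivity)
          calc ‖⟪U y, y⟫‖ ≤ ‖U y‖ * ‖y‖ := norm_inner_le_norm _ _
            _ ≤ C * (1 + ‖y‖) ^ N * (1 + ‖y‖) :=
                mul_le_mul (hU0 y) (by linarith [norm_nonneg y]) (norm_nonneg _) (by positivity)
            _ = C * (1 + ‖y‖) ^ (N + 1) := by ring
      _ = C * C ^ 2 * (1 + ‖y‖) ^ ((N + 1) + 2 * N) := by ring
  have iT : Integrable fun y => gaussWeight y * (P y * ⟪U y, y⟫) := by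
    refine integrable_gaussWeight_mul_of_norm_le
      (hP.continuous.mul (hU.continuous.inner continuous_id))
      (C := C * C) (N := N + (N + 1)) fun y => ?_
    rw [norm_mul]
    calc ‖P y‖ * ‖⟪U y, y⟫‖ ≤ (C * (1 + ‖y‖) ^ N) * (C * (1 + ‖y‖) ^ (N + 1)) := by
          refine mul_le_mul (hP0 y) ?_ (norm_nonneg _) (by positivity)
          calc ‖⟪U y, y⟫‖ ≤ ‖U y‖ * ‖y‖ := norm_inner_le_norm _ _
            _ ≤ C * (1 + ‖y‖) ^ N * (1 + ‖y‖) :=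
                mul_le_mul (hU0 y) (by linarith [norm_nonneg y]) (norm_nonneg _) (by positivity)
            _ = C * (1 + ‖y‖) ^ (N + 1) := by ring
      _ = C * C * (1 + ‖y‖) ^ (N + (N + 1)) := by ring
  have e2 : (fun y => gaussWeight y * (((1 / 2 : ℝ) * ‖U y‖ ^ 2 + P y) * ⟪U y, y⟫)) = fun y =>
      (1 / 2 : ℝ) * (gaussWeight y * (⟪U y, y⟫ * ‖U y‖ ^ 2)) + gaussWeight y * (P y * ⟪U y, y⟫) := by
    funext y; ring
  have iSh : Integrable fun y => (1 / 2 : ℝ) * (gaussWeight y * (⟪U y, y⟫ * ‖U y‖ ^ 2)) :=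
    iS.const_mul _
  rw [e2, integral_add iSh iT, integral_const_mul]
  ring


/-! ### The period average: `∫₀ᴸ (E + D + ½∫γ(½|U|² + P)(U·y)) ds = 0` for `s`-periodic solutions -/

/-- **Dominated differentiation of the Gaussian energy**: if `σ ↦ U(σ, y)` has derivative
`U_s(s, y)` for `s` near `s₀` and every `y`, with `U(s)`, `U_s(s)` continuous in `y` and of
polynomial growth uniformly in `s`, then `s ↦ ∫ γ |U(s)|²` is differentiable at `s₀` with derivative
`∫ γ · 2⟪U(s₀), U_s(s₀)⟫` (Mathlib's `hasDerivAt_integral_of_dominated_loc_of_deriv_le`). [folklore] -/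
private theorem hasDerivAt_integral_gaussWeight_mul_norm_sq
    {U Us : ℝ → EuclideanSpace ℝ (Fin 3) → EuclideanSpace ℝ (Fin 3)} {s₀ ε C : ℝ} {N : ℕ}
    (hε : 0 < ε) (hUc : ∀ s, Continuous (U s)) (hUsc : ∀ s, Continuous (Us s))
    (hbU : ∀ s y, ‖U s y‖ ≤ C * (1 + ‖y‖) ^ N) (hbUs : ∀ s y, ‖Us s y‖ ≤ C * (1 + ‖y‖) ^ N)
    (hs : ∀ s ∈ Ioo (s₀ - ε) (s₀ + ε), ∀ y, HasDerivAt (fun σ => U σ y) (Us s y) s) :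
    HasDerivAt (fun s => ∫ y, gaussWeight y * ‖U s y‖ ^ 2)
      (∫ y, gaussWeight y * (2 * ⟪U s₀ y, Us s₀ y⟫)) s₀ := by
  have hC : 0 ≤ C := by
    have := (norm_nonneg (U s₀ 0)).trans (hbU s₀ 0)
    simpa using this
  have hs₀ : Ioo (s₀ - ε) (s₀ + ε) ∈ 𝓝 s₀ := Ioo_mem_nhds (by linarith) (by linarith)
  have h := hasDerivAt_integral_of_dominated_loc_of_deriv_le (μ := volume)
    (F := fun σ y => gaussWeight y * ‖U σ y‖ ^ 2)
    (F' := fun σ y => gaussWeight y * (2 * ⟪U σ y, Us σ y⟫))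
    (bound := fun y => gaussWeight y * (2 * (C * C) * (1 + ‖y‖) ^ (N + N))) hs₀ ?_ ?_ ?_ ?_ ?_ ?_
  · exact h.2
  · exact Eventually.of_forall fun σ =>
      (continuous_gaussWeight.mul ((hUc σ).norm.pow 2)).aestronglyMeasurable
  · refine integrable_gaussWeight_mul_of_norm_le ((hUc s₀).norm.pow 2) (C := C ^ 2) (N := 2 * N)
      fun y => ?_
    rw [norm_pow, norm_norm]
    calc ‖U s₀ y‖ ^ 2 ≤ (C * (1 + ‖y‖) ^ N) ^ 2 := pow_le_pow_left₀ (norm_nonneg _) (hbU s₀ y) 2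
      _ = C ^ 2 * (1 + ‖y‖) ^ (2 * N) := by ring
  · exact (continuous_gaussWeight.mul
      (continuous_const.mul ((hUc s₀).inner (hUsc s₀)))).aestronglyMeasurable
  · refine Eventually.of_forall fun y σ _ => ?_
    rw [norm_mul, Real.norm_of_nonneg (gaussWeight_pos y).le]
    refine mul_le_mul_of_nonneg_left ?_ (gaussWeight_pos y).le
    rw [norm_mul, Real.norm_of_nonneg (by norm_num : (0 : ℝ) ≤ 2)]
    calc 2 * ‖⟪U σ y, Us σ y⟫‖ ≤ 2 * (‖U σ y‖ * ‖Us σ y‖) :=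
          mul_le_mul_of_nonneg_left (norm_inner_le_norm _ _) (by norm_num)
      _ ≤ 2 * ((C * (1 + ‖y‖) ^ N) * (C * (1 + ‖y‖) ^ N)) :=
          mul_le_mul_of_nonneg_left
            (mul_le_mul (hbU σ y) (hbUs σ y) (norm_nonneg _) (by positivity)) (by norm_num)
      _ = 2 * (C * C) * (1 + ‖y‖) ^ (N + N) := by ring
  · exact integrable_gaussWeight_mul_of_norm_le (by fun_prop) (C := 2 * (C * C)) (N := N + N)
      fun y => le_of_eq (Real.norm_of_nonneg (by positivity))
  · exact Eventually.of_forall fun y σ hσ => ((hs σ hσ y).norm_sq).const_mul (gaussWeight y)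

/-- **The period-averaged `L²_γ` energy balance of an `s`-periodic solution ((R)DSS members):
`∫₀ᴸ ( ½‖U(s)‖²_γ + ‖∇U(s)‖²_γ + ½ ∫ γ (½|U|² + P)(U·y) ) ds = 0`** whenever
`∂_sU + α𝓡U + ½U + ½DU[y] − ΔU + (U·∇)U + ∇P = 0` on `ℝ × ℝ³`, `∇·U = 0` and `U(L) = U(0)`:
the slice balance `integral_gaussWeight_mul_inner_sliceDeriv_eq` integrated in `s`, with
`d/ds ½‖U(s)‖²_γ = ⟨∂_sU, U⟩_γ` (dominated differentiation) and periodicity. Hypotheses: slices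
`U(s) ∈ C²`, `P(s) ∈ C¹`; `U`, `∂_sU =: U_s` continuous in `s` for each `y` and continuous in `y`
for each `s`; polynomial growth of `U, DU, D²U, P, DP, U_s` uniformly in `s`. This is the `L²_γ`
energy bookkeeping of (6.16a) with the `∂_sU` term of (7.7) retained (the Lemma 6.2 (i)–(ii)
pairings of p. 22) carried along one period; it is not displayed in the paper, whose §6 treats the
steady rotated profile and whose §7.4 runs the analogous period bookkeeping on the head-pressure side
((7.7)–(7.10), pp. 25–26: "The periodicity in `s` of the profile `U` is now used to make the last
term in the above identity disappear, upon integration in `s`").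
[cite: PineauVicol2026, Lemma 6.2 (i)–(ii) (p. 19), proof of Lemma 6.4 (pp. 21–22), (7.7)–(7.10) (pp. 25–26)] -/
theorem intervalIntegral_gaussEnergy_balance_eq_zero_of_periodic
    {U Us : ℝ → EuclideanSpace ℝ (Fin 3) → EuclideanSpace ℝ (Fin 3)}
    {P : ℝ → EuclideanSpace ℝ (Fin 3) → ℝ} {α L C : ℝ} {N : ℕ}
    (hU : ∀ s, ContDiff ℝ 2 (U s)) (hP : ∀ s, ContDiff ℝ 1 (P s))
    (hdiv : ∀ s, VectorCalculus.IsDivFree (U s)) (hUsc : ∀ s, Continuous (Us s))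
    (hUj : ∀ y, Continuous fun s => U s y) (hUsj : ∀ y, Continuous fun s => Us s y)
    (hbU : ∀ s y, ‖U s y‖ ≤ C * (1 + ‖y‖) ^ N) (hbDU : ∀ s y, ‖fderiv ℝ (U s) y‖ ≤ C * (1 + ‖y‖) ^ N)
    (hbD2U : ∀ s y, ‖fderiv ℝ (fderiv ℝ (U s)) y‖ ≤ C * (1 + ‖y‖) ^ N)
    (hbP : ∀ s y, ‖P s y‖ ≤ C * (1 + ‖y‖) ^ N) (hbDP : ∀ s y, ‖fderiv ℝ (P s) y‖ ≤ C * (1 + ‖y‖) ^ N)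
    (hbUs : ∀ s y, ‖Us s y‖ ≤ C * (1 + ‖y‖) ^ N)
    (hs : ∀ s y, HasDerivAt (fun σ => U σ y) (Us s y) s)
    (heq : ∀ s y, Us s y + α • (rotGen (U s y) - fderiv ℝ (U s) y (rotGen y)) +
      (1 / 2 : ℝ) • U s y + (1 / 2 : ℝ) • fderiv ℝ (U s) y y - (Δ (U s)) y +
      convect (U s) (U s) y + gradient (P s) y = 0)
    (hper : ∀ y, U L y = U 0 y) :
    ∫ s in (0 : ℝ)..L, ((1 / 2 : ℝ) * (∫ y, gaussWeight y * ‖U s y‖ ^ 2) +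
        (∫ y, gaussWeight y * ∑ i, ‖fderiv ℝ (U s) y (EuclideanSpace.basisFun (Fin 3) ℝ i)‖ ^ 2) +
        (1 / 2 : ℝ) * ∫ y, gaussWeight y * (((1 / 2 : ℝ) * ‖U s y‖ ^ 2 + P s y) * ⟪U s y, y⟫)) = 0 := by
  have hC : 0 ≤ C := by
    have := (norm_nonneg (U 0 0)).trans (hbU 0 0)
    simpa using this
  -- `E(s) = ½ ∫ γ |U(s)|²` has derivative `E'(s) = ⟨U_s, U⟩_γ`
  have hE : ∀ s, HasDerivAt (fun σ => (1 / 2 : ℝ) * ∫ y, gaussWeight y * ‖U σ y‖ ^ 2)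
      (∫ y, gaussWeight y * ⟪Us s y, U s y⟫) s := by
    intro s
    have h := (hasDerivAt_integral_gaussWeight_mul_norm_sq (s₀ := s) zero_lt_one
      (fun σ => (hU σ).continuous) hUsc hbU hbUs (fun σ _ y => hs σ y)).const_mul (1 / 2 : ℝ)
    have e : (1 / 2 : ℝ) * ∫ y, gaussWeight y * (2 * ⟪U s y, Us s y⟫) =
        ∫ y, gaussWeight y * ⟪Us s y, U s y⟫ := by
      rw [← integral_const_mul]
      refine integral_congr_ae (Eventually.of_forall fun y => ?_)
      dsimp only
      rw [real_inner_comm (Us s y) (U s y)]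
      ring
    rw [e] at h
    exact h
  -- `E'` is continuous in `s` (dominated convergence), hence interval integrable
  have hE'c : Continuous fun s => ∫ y, gaussWeight y * ⟪Us s y, U s y⟫ := by
    refine continuous_of_dominated (μ := volume)
      (F := fun s y => gaussWeight y * ⟪Us s y, U s y⟫)
      (bound := fun y => gaussWeight y * ((C * C) * (1 + ‖y‖) ^ (N + N)))
      (fun s => (continuous_gaussWeight.mul ((hUsc s).inner (hU s).continuous)).aestronglyMeasurable)
      (fun s => Eventually.of_forall fun y => ?_) ?_
      (Eventually.of_forall fun y => continuous_const.mul ((hUsj y).inner (hUj y)))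
    · rw [norm_mul, Real.norm_of_nonneg (gaussWeight_pos y).le]
      refine mul_le_mul_of_nonneg_left ?_ (gaussWeight_pos y).le
      calc ‖⟪Us s y, U s y⟫‖ ≤ ‖Us s y‖ * ‖U s y‖ := norm_inner_le_norm _ _
        _ ≤ (C * (1 + ‖y‖) ^ N) * (C * (1 + ‖y‖) ^ N) :=
            mul_le_mul (hbUs s y) (hbU s y) (norm_nonneg _) (by positivity)
        _ = C * C * (1 + ‖y‖) ^ (N + N) := by ring
    · exact integrable_gaussWeight_mul_of_norm_le (by fun_prop) (C := C * C) (N := N + N)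
        fun y => le_of_eq (Real.norm_of_nonneg (by positivity))
  -- FTC over one period and periodicity
  have hFTC : ∫ s in (0 : ℝ)..L, (∫ y, gaussWeight y * ⟪Us s y, U s y⟫) =
      (1 / 2 : ℝ) * (∫ y, gaussWeight y * ‖U L y‖ ^ 2) -
        (1 / 2 : ℝ) * ∫ y, gaussWeight y * ‖U 0 y‖ ^ 2 :=
    intervalIntegral.integral_eq_sub_of_hasDerivAt (fun s _ => hE s) (hE'c.intervalIntegrable _ _)
  have hper' : (fun y => gaussWeight y * ‖U L y‖ ^ 2) = fun y => gaussWeight y * ‖U 0 y‖ ^ 2 := by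
    funext y; rw [hper y]
  rw [hper', sub_self] at hFTC
  -- the slice balance says the integrand is `−E'(s)`
  have hslice : ∀ s, ∫ y, gaussWeight y * ⟪Us s y, U s y⟫ =
      -((1 / 2 : ℝ) * ∫ y, gaussWeight y * ‖U s y‖ ^ 2) -
        (∫ y, gaussWeight y * ∑ i, ‖fderiv ℝ (U s) y (EuclideanSpace.basisFun (Fin 3) ℝ i)‖ ^ 2) -
        (1 / 2 : ℝ) * ∫ y, gaussWeight y * (((1 / 2 : ℝ) * ‖U s y‖ ^ 2 + P s y) * ⟪U s y, y⟫) :=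
    fun s => integral_gaussWeight_mul_inner_sliceDeriv_eq (hU s) (hP s) (hdiv s) (hbU s) (hbDU s)
      (hbD2U s) (hbP s) (hbDP s) (heq s)
  have h1 : ∫ s in (0 : ℝ)..L, ((1 / 2 : ℝ) * (∫ y, gaussWeight y * ‖U s y‖ ^ 2) +
      (∫ y, gaussWeight y * ∑ i, ‖fderiv ℝ (U s) y (EuclideanSpace.basisFun (Fin 3) ℝ i)‖ ^ 2) +
      (1 / 2 : ℝ) * ∫ y, gaussWeight y * (((1 / 2 : ℝ) * ‖U s y‖ ^ 2 + P s y) * ⟪U s y, y⟫)) =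
      ∫ s in (0 : ℝ)..L, -(∫ y, gaussWeight y * ⟪Us s y, U s y⟫) :=
    intervalIntegral.integral_congr fun s _ => by
      rw [hslice s]
      ring
  rw [h1, intervalIntegral.integral_neg, hFTC, neg_zero]

end PineauVicol2026

end Literature.Analysis.FluidPDE

end
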